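import Literature.RepresentationTheory.FiniteGroups.KLRGradedCellularBasisTableauDegrees
import Literature.RepresentationTheory.FiniteGroups.KLRGradedCellularBasisProofs
import Literature.NumberTheory.DiophantineGeometry.SymmetricGroupReps
import Mathlib.Data.Nat.Choose.Sum
import Mathlib.LinearAlgebra.Dimension.OrzechProperty
import HarnessLib

/-!
# Towards Murphy's standard basis of `R[S_n]` (Hu–Mathas 2010, §2.3 / Thm 26 for `𝔽_p S_n`)

Hu–Mathas' graded cellular basis `ψ_{𝔰𝔱} = ψ*_{d(𝔰)} e_λ y_λ ψ_{d(𝔱)}` (arXiv:0907.2985, §5) is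
proved to be a basis by comparing it with Murphy's standard basis
`m_{𝔰𝔱} = T*_{d(𝔰)} x_λ T_{d(𝔱)}` of the Hecke algebra (Hu–Mathas Thm 26, citing Murphy and
Dipper–James–Mathas; for the symmetric group: G. E. Murphy, J. Algebra 173 (1995)). This file
sets up the objects over an arbitrary commutative ring `R` in the tree's vocabulary:

* `murphyX R λ = x_λ = ∑_{σ ∈ S_λ} σ`, the row symmetrizer of the row-reading tableau `𝔱^λ`
  (`rowStabilizer`, file `SymmetricGroupReps`; there `rowSymmetrizer` is the same sum over a
  field), absorbing `S_λ` on both sides (`of_mul_murphyX`, `murphyX_mul_of`);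
* `wordPerm T = w_T`, the permutation with `T = w_T · 𝔱^λ`, i.e. `T.1 ∘ w_T = (𝔱^λ).1`
  (`apply_wordPerm`; `wordPerm_rowReading : w_{𝔱^λ} = 1`; under an admissible step of file
  `TableauDegrees`, `w_{s_r T} = s_r w_T`, `wordPerm_stdFillingSwap`);
* `murphy R 𝔰 𝔱 = m_{𝔰𝔱} := w_𝔰 x_λ w_𝔱⁻¹` with `m_{𝔱^λ𝔱^λ} = x_λ` and
  `m_{𝔰𝔱} = ∑_{σ ∈ S_λ} w_𝔰 σ w_𝔱⁻¹` (`murphy_eq_sum`); the row classes (`w' x_λ = w x_λ` iff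
  `w⁻¹ w' ∈ S_λ` iff `w · 𝔱^λ`, `w' · 𝔱^λ` are row equivalent: `of_mul_murphyX_eq_of_inv_mul_mem`,
  `inv_mul_mem_rowStabilizer_iff`);
* the anti-involution `grpAlgStar R : x ↦ x*`, `g* = g⁻¹`, over any commutative ring
  (`grpAlgStar_mul`, `grpAlgStar_grpAlgStar`), with `x_λ* = x_λ` and **`m_{𝔰𝔱}* = m_{𝔱𝔰}`**
  (`grpAlgStar_murphy`);
* the row stabilizer `rowStab T = w_T S_λ w_T⁻¹` of a tableau (`mem_rowStab_iff_conj_mem`,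
  `rowStab_rowReading`) and the **Murphy set** `murphyFinset 𝔰 𝔱 = {g : g carries every entry of
  𝔱 to an entry of 𝔰 in the same row}` with **`m_{𝔰𝔱} = ∑_{g ∈ murphyFinset 𝔰 𝔱} g`**
  (`murphy_eq_sum_murphyFinset`, `coeff_murphy`); Murphy sets of non-row-equivalent `𝔰, 𝔰'`
  are disjoint, whence the `m_{𝔰𝔱}` with pairwise non-row-equivalent `𝔰` are linearly
  independent (`linearIndependent_murphy_of_pairwise` — the permutation module is free on
  tabloids);
* the dominance order on (row classes of) tableaux through the prefix counts `rowCount`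
  (`FillingDominates`, reflexive, transitive, antisymmetric on row classes:
  `FillingDominates.row_eq`) and **the basic dominance move** of the row-Garnir straightening:
  exchanging the rows of a smaller, lower entry and a larger, higher entry gives a strictly more
  dominant tableau (`fillingDominates_of_exchange`, `rowCount_lt_of_exchange`);
* Young subgroups `blockStab blk` of set partitions of the entries (block labels `blk`;
  `rowStabilizer λ` and `rowStab T` are instances) with the conjugation rule
  `Stab(blk ∘ π⁻¹) = π Stab(blk) π⁻¹`, their sums `blockSum R blk = x_P` with
  **`x_{P∘π⁻¹} = π x_P π⁻¹`** (`blockSum_comp_inv`), **`x_{Row T} = w_T x_λ w_T⁻¹`**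
  (`blockSum_row_eq`) and `m_{𝔰𝔱} = x_{Row 𝔰} (w_𝔰 w_𝔱⁻¹) = (w_𝔰 w_𝔱⁻¹) x_{Row 𝔱}`;
* **tabloids**: the row function `rowFunOf λ h` of `h · 𝔱^λ` (`rowFunOf_mul`, `rowFunOf_eq_iff`:
  equal iff same left coset of `S_λ`, `rowFunOf_wordPerm`), the tabloid elements
  `tabloidSum R λ r = ∑_{h : rows of h·𝔱^λ = r} h` with `tabloidSum (rows of g·𝔱^λ) = g x_λ`,
  `m_{T𝔱^λ} = tabloidSum (rows of T)`, `g · tabloidSum r = tabloidSum (r ∘ g⁻¹)`, their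
  coefficients, sums over sets of tabloids as sums over fibres (`sum_tabloidSum`), and
  **`H x_λ` is free on tabloids** (`linearIndependent_tabloidSum`) — layer L1 of the
  straightening plan;
* layer L2–L3: the inclusion–exclusion identity over a forbidden set
  (`sum_filter_disjoint_eq_sum_powerset`) and **sums over `S_Q`-stable sets are left multiples of
  `x_Q`** (`exists_sum_eq_blockSum_mul`, by splitting off right cosets;
  `exists_sum_tabloidSum_eq_blockSum_mul` for orbit sums of tabloids — the terms `N(U₀)` of the
  row-Garnir element).

* layer L4: block sizes and their invariance (`blockSize_comp_perm`, labellings with the same block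
  sizes are conjugate: `exists_perm_comp_eq`, `exists_blockSum_eq_conj`), the **sort-free dominance
  order on types through the column counts** `colCount Q t = ∑_blocks min(|b|, t)` (`LabDom`,
  `LabSDom`, transitivity, the basic move `labSDom_of_move`: moving `m ≥ 1` entries from a block to
  a block at least as large is a strict dominance move), the two-sided ideals
  **`domIdeal R Q₀ = J^{▷Q₀} = span{g x_Q h : Q ▷ Q₀}`** (`mul_mem_domIdeal_left/right`,
  `domIdeal_mono`, `domIdeal_congr`, `*`-stable), the row sizes `λ_i` of tableaux and tabloids
  (`blockSize_rows`, `blockSize_rowFunOf`, `colCount_rowFunOf`), and **the row-Garnir element lies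
  in `J^{▷λ}`** (`garnir_sum_mem_domIdeal`: the Garnir row functions `garnirFun`, the stability of
  their orbits `garnirFun_comp_inv`, the orbit sums `N(U₀) ∈ x_{r_{U₀}} H`
  (`sum_tabloidSum_garnir_supset_mem`) and `r_{U₀} ▷ r` (`labSDom_garnirFun`));
* layer L5, **straightening** (`tabloidSum_mem_stdSpan_sup`, `of_mul_murphyX_mem_stdSpan_sup`):
  `g x_λ ∈ ∑_{𝔳 standard, 𝔳 ⊵ g·𝔱^λ} R m_{𝔳𝔱^λ} + J^{▷λ}`, by induction on a dominance potential
  (`domPot`): the tableau of a row function without descents is standard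
  (`isStdFilling_fillOfRowFun`, positions `colIdx`), a descent yields Garnir data
  (`exists_garnir_data`), and the other Garnir terms are strictly more dominant
  (`rowSDom_garnirFun`, iterating the exchange move).

* layer L6, **Murphy's standard basis theorem**: the type `typeOf Q` of a labelling (a partition
  of `n` with the block sizes as parts, `blockSizes`), every `x_Q` is conjugate to the `x_μ` of its
  type (`exists_blockSum_eq_conj_murphyX`, through a size-preserving matching of the labels,
  `exists_perm_of_blockSizes_eq`), `g x_λ h ∈ ∑ R m_{𝔲𝔳} + J^{▷λ}` (`of_mul_murphyX_mul_of_mem`),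
  **every `g x_Q h` lies in the span of the `m_{𝔲𝔳}` of the shapes dominating `Q`**
  (`conj_blockSum_mem_murphySpanDom`, downward induction on dominance), hence
  `J^{▷Q} ⊆ span{m_{𝔲𝔳} : shape ▷ Q}` (`domIdeal_le_murphySpanSDom`), **the `m_{𝔰𝔱}` span `R[S_n]`**
  (`span_murphy_eq_top`, any commutative ring) and form **the Murphy basis `murphyBasis k n` of
  `k[S_n]` over a field** (`TableauPair`-indexed; `linearIndependent_murphy`).

Still missing: the Jucys–Murphy triangularity `m_{𝔰𝔱} L_k ≡ res_𝔱(k) m_{𝔰𝔱} + higher terms`.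

## References

* J. Hu, A. Mathas, *Graded cellular bases for the cyclotomic Khovanov–Lauda–Rouquier algebras of
  type A*, Adv. Math. 225 (2010), arXiv:0907.2985, §2.3 and Theorem 26 (`m_{𝔰𝔱}`, `m_λ`).
  [HuMathas2010]
-/

noncomputable section

open scoped BigOperators

namespace Literature.RepresentationTheory.FiniteGroups

open Equiv Literature.NumberTheory.DiophantineGeometry

variable (R : Type*) [CommRing R] {n : ℕ}

/-! ### `x_λ` -/

open scoped Classical in
/-- **`x_λ = ∑_{σ ∈ S_λ} σ ∈ R[S_n]`**, the sum over the row stabilizer of the row-reading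
tableau `𝔱^λ` (Hu–Mathas' `m_λ = x_λ` at level one, `u⁺_λ = 1`). [cite: HuMathas2010, §2.3] -/
def murphyX (μ : Nat.Partition n) : MonoidAlgebra R (Perm (Fin n)) :=
  ∑ σ ∈ Finset.univ.filter (fun σ : Perm (Fin n) => σ ∈ rowStabilizer μ), MonoidAlgebra.of R _ σ

open scoped Classical in
/-- `τ x_λ = x_λ` for `τ ∈ S_λ`. [folklore] -/
theorem of_mul_murphyX {μ : Nat.Partition n} {τ : Perm (Fin n)} (hτ : τ ∈ rowStabilizer μ) :
    MonoidAlgebra.of R _ τ * murphyX R μ = murphyX R μ := by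
  unfold murphyX
  rw [Finset.mul_sum]
  simp_rw [← map_mul]
  refine Finset.sum_bij' (fun σ _ => τ * σ) (fun σ _ => τ⁻¹ * σ) (fun σ hσ => ?_) (fun σ hσ => ?_)
    (fun σ _ => by group) (fun σ _ => by group) (fun σ _ => rfl)
  · rw [Finset.mem_filter] at hσ ⊢
    exact ⟨Finset.mem_univ _, mul_mem hτ hσ.2⟩
  · rw [Finset.mem_filter] at hσ ⊢
    exact ⟨Finset.mem_univ _, mul_mem (inv_mem hτ) hσ.2⟩

open scoped Classical in
/-- `x_λ τ = x_λ` for `τ ∈ S_λ`. [folklore] -/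
theorem murphyX_mul_of {μ : Nat.Partition n} {τ : Perm (Fin n)} (hτ : τ ∈ rowStabilizer μ) :
    murphyX R μ * MonoidAlgebra.of R _ τ = murphyX R μ := by
  unfold murphyX
  rw [Finset.sum_mul]
  simp_rw [← map_mul]
  refine Finset.sum_bij' (fun σ _ => σ * τ) (fun σ _ => σ * τ⁻¹) (fun σ hσ => ?_) (fun σ hσ => ?_)
    (fun σ _ => by group) (fun σ _ => by group) (fun σ _ => rfl)
  · rw [Finset.mem_filter] at hσ ⊢
    exact ⟨Finset.mem_univ _, mul_mem hσ.2 hτ⟩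
  · rw [Finset.mem_filter] at hσ ⊢
    exact ⟨Finset.mem_univ _, mul_mem hσ.2 (inv_mem hτ)⟩

/-! ### `w_T` -/

section WordPerm

variable {R} {μ : Nat.Partition n}

/-- A standard `λ`-tableau as a bijection from the entries onto the cells. [folklore] -/
def cellEquiv (T : StdFilling n μ.youngDiagram) : Fin n ≃ μ.youngDiagram.cells :=
  Equiv.ofBijective _ (T.bijective μ.card_cells_youngDiagram)

/-- The cell of the entry `j`. [folklore] -/
theorem cellEquiv_apply (T : StdFilling n μ.youngDiagram) (j : Fin n) : (cellEquiv T j : ℕ × ℕ) = T.1 j := rfl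

/-- **`w_T`**: the permutation of the entries with `T = w_T · 𝔱^λ`, i.e. the entry of `T` in the
cell where `𝔱^λ` has `j` is `w_T j` (BKW §3.2; Hu–Mathas' `d(𝔱)`, `𝔱 = 𝔱^λ d(𝔱)`). [folklore] -/
def wordPerm (T : StdFilling n μ.youngDiagram) : Perm (Fin n) :=
  (cellEquiv (rowReading μ)).trans (cellEquiv T).symm

/-- `T (w_T j) = 𝔱^λ j`: `w_T` carries the numbering of `𝔱^λ` to that of `T` cell by cell.
[folklore] -/
theorem apply_wordPerm (T : StdFilling n μ.youngDiagram) (j : Fin n) :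
    T.1 (wordPerm T j) = (rowReading μ).1 j := by
  have := (cellEquiv T).apply_symm_apply (cellEquiv (rowReading μ) j)
  exact congrArg Subtype.val this

/-- `w_T` is characterised by `T ∘ w_T = 𝔱^λ`. [folklore] -/
theorem wordPerm_eq_iff (T : StdFilling n μ.youngDiagram) (w : Perm (Fin n)) :
    wordPerm T = w ↔ ∀ j, T.1 (w j) = (rowReading μ).1 j := by
  constructor
  · rintro rfl j; exact apply_wordPerm T j
  · intro h
    ext j
    exact congrArg Fin.val (T.injective ((apply_wordPerm T j).trans (h j).symm))

/-- `w_{𝔱^λ} = 1`. [folklore] -/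
theorem wordPerm_rowReading : wordPerm (rowReading μ) = 1 :=
  (wordPerm_eq_iff _ _).2 fun _ => rfl

/-- Under an admissible step `T ↦ s_r T` (file `TableauDegrees`), `w_{s_r T} = s_r w_T`.
[folklore] -/
theorem wordPerm_stdFillingSwap (T : StdFilling n μ.youngDiagram) {r r' : Fin n} (h : (r' : ℕ) = r + 1)
    (hinc : ¬ (T.1 r ≤ T.1 r')) :
    wordPerm (stdFillingSwap T h hinc) = Equiv.swap r r' * wordPerm T := by
  rw [wordPerm_eq_iff]
  intro j
  show (T.1 ∘ Equiv.swap r r') (Equiv.swap r r' (wordPerm T j)) = _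
  rw [Function.comp_apply, Equiv.swap_apply_self, apply_wordPerm]

end WordPerm

/-! ### `m_{𝔰𝔱}` -/

/-- **Murphy's element `m_{𝔰𝔱} = w_𝔰 x_λ w_𝔱⁻¹`** for standard `λ`-tableaux `𝔰, 𝔱` (Hu–Mathas'
`m_{𝔰𝔱} = T*_{d(𝔰)} m_λ T_{d(𝔱)}` at `q = 1`, level one). [cite: HuMathas2010, §2.3] -/
def murphy {μ : Nat.Partition n} (s t : StdFilling n μ.youngDiagram) : MonoidAlgebra R (Perm (Fin n)) :=
  MonoidAlgebra.of R _ (wordPerm s) * murphyX R μ * MonoidAlgebra.of R _ (wordPerm t)⁻¹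

/-- `m_{𝔱^λ 𝔱^λ} = x_λ`. [folklore] -/
theorem murphy_rowReading (μ : Nat.Partition n) : murphy R (rowReading μ) (rowReading μ) = murphyX R μ := by
  rw [murphy, wordPerm_rowReading, inv_one, map_one, one_mul, mul_one]

open scoped Classical in
/-- `m_{𝔰𝔱} = ∑_{σ ∈ S_λ} w_𝔰 σ w_𝔱⁻¹`. [folklore] -/
theorem murphy_eq_sum {μ : Nat.Partition n} (s t : StdFilling n μ.youngDiagram) :
    murphy R s t = ∑ σ ∈ Finset.univ.filter (fun σ : Perm (Fin n) => σ ∈ rowStabilizer μ),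
      MonoidAlgebra.of R _ (wordPerm s * σ * (wordPerm t)⁻¹) := by
  rw [murphy, murphyX, Finset.mul_sum, Finset.sum_mul]
  refine Finset.sum_congr rfl fun σ _ => ?_
  rw [map_mul, map_mul]

/-! ### Row classes: `w x_λ` only depends on the rows of `w · 𝔱^λ` -/

/-- `w' x_λ = w x_λ` when `w⁻¹ w' ∈ S_λ`. [folklore] -/
theorem of_mul_murphyX_eq_of_inv_mul_mem {μ : Nat.Partition n} {w w' : Perm (Fin n)}
    (h : w⁻¹ * w' ∈ rowStabilizer μ) :
    MonoidAlgebra.of R _ w' * murphyX R μ = MonoidAlgebra.of R _ w * murphyX R μ := by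
  conv_lhs => rw [show w' = w * (w⁻¹ * w') by group, map_mul, mul_assoc, of_mul_murphyX R h]

/-- `x_λ w'⁻¹ = x_λ w⁻¹` when `w⁻¹ w' ∈ S_λ` (the mirror image). [folklore] -/
theorem murphyX_mul_of_inv_eq_of_inv_mul_mem {μ : Nat.Partition n} {w w' : Perm (Fin n)}
    (h : w⁻¹ * w' ∈ rowStabilizer μ) :
    murphyX R μ * MonoidAlgebra.of R _ w'⁻¹ = murphyX R μ * MonoidAlgebra.of R _ w⁻¹ := by
  have h' : w'⁻¹ * w ∈ rowStabilizer μ := by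
    have := inv_mem h
    rwa [mul_inv_rev, inv_inv] at this
  conv_lhs => rw [show w'⁻¹ = (w'⁻¹ * w) * w⁻¹ by group, map_mul, ← mul_assoc, murphyX_mul_of R h']

/-- The tableau `w · 𝔱^λ` (entries moved by `w`): its growth sequence is `(𝔱^λ).1 ∘ w⁻¹`; two
permutations give row-equivalent tableaux iff they lie in the same left coset of `S_λ`.
[folklore] -/
theorem inv_mul_mem_rowStabilizer_iff {μ : Nat.Partition n} (w w' : Perm (Fin n)) :
    w⁻¹ * w' ∈ rowStabilizer μ ↔
      ∀ j : Fin n, ((rowReading μ).1 (w⁻¹ j)).1 = ((rowReading μ).1 (w'⁻¹ j)).1 := by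
  rw [mem_rowStabilizer_iff]
  simp only [rowReading_apply, Perm.mul_apply]
  constructor
  · intro h j
    simpa only [Perm.inv_def, Equiv.apply_symm_apply] using h (w'⁻¹ j)
  · intro h i
    simpa only [Perm.inv_def, Equiv.symm_apply_apply] using h (w' i)

/-- For a standard tableau `T`, `T = w_T · 𝔱^λ`: the growth sequence of `T` is `(𝔱^λ).1 ∘ w_T⁻¹`.
[folklore] -/
theorem rowReading_apply_wordPerm_inv {μ : Nat.Partition n} (T : StdFilling n μ.youngDiagram) (j : Fin n) :
    (rowReading μ).1 ((wordPerm T)⁻¹ j) = T.1 j := by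
  have := apply_wordPerm T ((wordPerm T)⁻¹ j)
  simp only [Perm.inv_def, Equiv.apply_symm_apply] at this ⊢
  exact this.symm


/-! ### The anti-involution `w ↦ w⁻¹` -/

section Star

variable {G : Type*} [Group G]

/-- The `R`-linear anti-involution `x ↦ x* = ∑_g x(g) g⁻¹` of a group algebra over a commutative
ring (the tree's `grpAlgFlip` is the same map over a field). [folklore] -/
def grpAlgStar : MonoidAlgebra R G ≃ₗ[R] MonoidAlgebra R G :=
  MonoidAlgebra.mapDomainLinearEquiv R R (Equiv.inv G)

/-- `(r g)* = r g⁻¹`. [folklore] -/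
@[simp]
theorem grpAlgStar_single (g : G) (r : R) :
    grpAlgStar R (MonoidAlgebra.single g r) = MonoidAlgebra.single g⁻¹ r := by
  simp [grpAlgStar]

/-- `g* = g⁻¹`. [folklore] -/
@[simp]
theorem grpAlgStar_of (g : G) : grpAlgStar R (MonoidAlgebra.of R G g) = MonoidAlgebra.of R G g⁻¹ := by
  rw [MonoidAlgebra.of_apply, MonoidAlgebra.of_apply, grpAlgStar_single]

/-- `*` is an anti-homomorphism: `(x y)* = y* x*`. [folklore] -/
theorem grpAlgStar_mul (x y : MonoidAlgebra R G) : grpAlgStar R (x * y) = grpAlgStar R y * grpAlgStar R x := by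
  induction x using MonoidAlgebra.induction_on with
  | hM g =>
    induction y using MonoidAlgebra.induction_on with
    | hM h =>
      simp only [MonoidAlgebra.of_apply, MonoidAlgebra.single_mul_single, grpAlgStar_single, mul_inv_rev, mul_one]
    | hadd y z hy hz => rw [mul_add, map_add, hy, hz, map_add, add_mul]
    | hsmul r y hy => rw [mul_smul_comm, map_smul, hy, map_smul, smul_mul_assoc]
  | hadd x z hx hz => rw [add_mul, map_add, hx, hz, map_add, mul_add]
  | hsmul r x hx => rw [smul_mul_assoc, map_smul, hx, map_smul, mul_smul_comm]

/-- `*` is an involution. [folklore] -/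
theorem grpAlgStar_grpAlgStar (x : MonoidAlgebra R G) : grpAlgStar R (grpAlgStar R x) = x := by
  induction x using MonoidAlgebra.induction_on with
  | hM g => rw [grpAlgStar_of, grpAlgStar_of, inv_inv]
  | hadd x y hx hy => rw [map_add, map_add, hx, hy]
  | hsmul r x hx => rw [map_smul, map_smul, hx]

end Star

open scoped Classical in
/-- `x_λ* = x_λ` (`S_λ` is a subgroup). [folklore] -/
theorem grpAlgStar_murphyX (μ : Nat.Partition n) : grpAlgStar R (murphyX R μ) = murphyX R μ := by
  unfold murphyX
  rw [map_sum]
  simp_rw [grpAlgStar_of]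
  refine Finset.sum_bij' (fun σ _ => σ⁻¹) (fun σ _ => σ⁻¹) (fun σ hσ => ?_) (fun σ hσ => ?_)
    (fun σ _ => inv_inv σ) (fun σ _ => inv_inv σ) (fun σ _ => rfl)
  · rw [Finset.mem_filter] at hσ ⊢; exact ⟨Finset.mem_univ _, inv_mem hσ.2⟩
  · rw [Finset.mem_filter] at hσ ⊢; exact ⟨Finset.mem_univ _, inv_mem hσ.2⟩

/-- **`m_{𝔰𝔱}* = m_{𝔱𝔰}`.** [folklore] -/
theorem grpAlgStar_murphy {μ : Nat.Partition n} (s t : StdFilling n μ.youngDiagram) :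
    grpAlgStar R (murphy R s t) = murphy R t s := by
  rw [murphy, grpAlgStar_mul, grpAlgStar_mul, grpAlgStar_of, grpAlgStar_of, grpAlgStar_murphyX, inv_inv, murphy,
    mul_assoc]


/-! ### The Murphy set: `m_{𝔰𝔱} = ∑ {g : g carries every entry of 𝔱 to an entry of 𝔰 in the same row}` -/

section MurphySet

variable {R} {μ : Nat.Partition n}

/-- The row of the entry `e` of `T` is the canonical row of `w_T⁻¹ e`. [folklore] -/
theorem row_eq_rowOf_wordPerm_inv (T : StdFilling n μ.youngDiagram) (e : Fin n) :
    (T.1 e).1 = μ.rowOf ((wordPerm T)⁻¹ e) := by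
  rw [← rowReading_apply_wordPerm_inv T e, rowReading_apply]

/-- **The row stabilizer of a tableau** `T` (permutations of the entries preserving the row of
every entry). [folklore] -/
def rowStab (T : StdFilling n μ.youngDiagram) : Subgroup (Perm (Fin n)) where
  carrier := {σ | ∀ e, (T.1 (σ e)).1 = (T.1 e).1}
  one_mem' := fun _ => rfl
  mul_mem' {σ τ} hσ hτ e := by rw [Perm.mul_apply, hσ, hτ]
  inv_mem' {σ} hσ e := by
    have := hσ (σ⁻¹ e)
    simp only [Perm.inv_def, Equiv.apply_symm_apply] at this ⊢
    exact this.symm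

/-- Membership in the row stabilizer of a tableau. [folklore] -/
theorem mem_rowStab_iff (T : StdFilling n μ.youngDiagram) (σ : Perm (Fin n)) :
    σ ∈ rowStab T ↔ ∀ e, (T.1 (σ e)).1 = (T.1 e).1 := Iff.rfl

/-- `RowStab(T) = w_T S_λ w_T⁻¹`: `σ` stabilises the rows of `T` iff `w_T⁻¹ σ w_T ∈ S_λ`. [folklore] -/
theorem mem_rowStab_iff_conj_mem (T : StdFilling n μ.youngDiagram) (σ : Perm (Fin n)) :
    σ ∈ rowStab T ↔ (wordPerm T)⁻¹ * σ * wordPerm T ∈ rowStabilizer μ := by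
  rw [mem_rowStab_iff, mem_rowStabilizer_iff]
  simp only [Perm.mul_apply, row_eq_rowOf_wordPerm_inv T]
  constructor
  · intro h i
    simpa only [Perm.inv_def, Equiv.symm_apply_apply] using h (wordPerm T i)
  · intro h e
    simpa only [Perm.inv_def, Equiv.apply_symm_apply] using h ((wordPerm T)⁻¹ e)

/-- `RowStab(𝔱^λ) = S_λ`. [folklore] -/
theorem rowStab_rowReading : rowStab (rowReading μ) = rowStabilizer μ := by
  ext σ
  rw [mem_rowStab_iff_conj_mem, wordPerm_rowReading, inv_one, one_mul, mul_one]

/-- **The Murphy set of `(𝔰, 𝔱)`**: the permutations carrying every entry of `𝔱` to an entry of `𝔰`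
lying in the same row. [folklore] -/
def murphyFinset (S T : StdFilling n μ.youngDiagram) : Finset (Perm (Fin n)) :=
  Finset.univ.filter fun g => ∀ e, (S.1 (g e)).1 = (T.1 e).1

/-- Membership in the Murphy set. [folklore] -/
theorem mem_murphyFinset {S T : StdFilling n μ.youngDiagram} {g : Perm (Fin n)} :
    g ∈ murphyFinset S T ↔ ∀ e, (S.1 (g e)).1 = (T.1 e).1 := by
  rw [murphyFinset, Finset.mem_filter, and_iff_right (Finset.mem_univ _)]

/-- `w_𝔰 σ w_𝔱⁻¹` lies in the Murphy set iff `σ ∈ S_λ`. [folklore] -/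
theorem conj_mem_murphyFinset_iff (S T : StdFilling n μ.youngDiagram) (σ : Perm (Fin n)) :
    wordPerm S * σ * (wordPerm T)⁻¹ ∈ murphyFinset S T ↔ σ ∈ rowStabilizer μ := by
  rw [mem_murphyFinset, mem_rowStabilizer_iff]
  simp only [Perm.mul_apply, row_eq_rowOf_wordPerm_inv S, row_eq_rowOf_wordPerm_inv T]
  constructor
  · intro h i
    simpa only [Perm.inv_def, Equiv.symm_apply_apply] using h (wordPerm T i)
  · intro h e
    simpa only [Perm.inv_def, Equiv.symm_apply_apply] using h ((wordPerm T)⁻¹ e)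

open scoped Classical in
/-- **`m_{𝔰𝔱} = ∑_{g ∈ Murphy set} g`.** [folklore] -/
theorem murphy_eq_sum_murphyFinset (S T : StdFilling n μ.youngDiagram) :
    murphy R S T = ∑ g ∈ murphyFinset S T, MonoidAlgebra.of R _ g := by
  rw [murphy_eq_sum]
  refine Finset.sum_bij' (fun σ _ => wordPerm S * σ * (wordPerm T)⁻¹)
    (fun g _ => (wordPerm S)⁻¹ * g * wordPerm T) (fun σ hσ => ?_) (fun g hg => ?_)
    (fun σ _ => by group) (fun g _ => by group) (fun σ _ => rfl)
  · rw [Finset.mem_filter] at hσ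
    exact (conj_mem_murphyFinset_iff S T σ).2 hσ.2
  · rw [Finset.mem_filter]
    refine ⟨Finset.mem_univ _, (conj_mem_murphyFinset_iff S T _).1 ?_⟩
    rwa [show wordPerm S * ((wordPerm S)⁻¹ * g * wordPerm T) * (wordPerm T)⁻¹ = g by group]

open scoped Classical in
/-- The coefficients of `m_{𝔰𝔱}`: `1` on the Murphy set, `0` elsewhere. [folklore] -/
theorem coeff_murphy (S T : StdFilling n μ.youngDiagram) (g : Perm (Fin n)) :
    (murphy R S T).coeff g = if g ∈ murphyFinset S T then 1 else 0 := by
  rw [murphy_eq_sum_murphyFinset, MonoidAlgebra.coeff_sum, Finset.sum_apply']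
  simp only [MonoidAlgebra.of_apply, MonoidAlgebra.coeff_single, Finsupp.single_apply]
  rw [Finset.sum_ite_eq' (murphyFinset S T) g (fun _ => (1 : R))]

/-- The Murphy set of `(𝔱^λ, 𝔱^λ)` is `S_λ`, so `m_{𝔱^λ𝔱^λ} = x_λ` once more. [folklore] -/
theorem mem_murphyFinset_rowReading_iff (g : Perm (Fin n)) :
    g ∈ murphyFinset (rowReading μ) (rowReading μ) ↔ g ∈ rowStabilizer μ := by
  rw [mem_murphyFinset, mem_rowStabilizer_iff]
  simp only [rowReading_apply]

/-- The Murphy sets of `(𝔰, 𝔱)` and `(𝔱, 𝔰)` are inverse to each other. [folklore] -/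
theorem inv_mem_murphyFinset_iff {S T : StdFilling n μ.youngDiagram} (g : Perm (Fin n)) :
    g⁻¹ ∈ murphyFinset T S ↔ g ∈ murphyFinset S T := by
  rw [mem_murphyFinset, mem_murphyFinset]
  constructor
  · intro h e
    simpa only [Perm.inv_def, Equiv.symm_apply_apply] using (h (g e)).symm
  · intro h e
    simpa only [Perm.inv_def, Equiv.apply_symm_apply] using (h (g⁻¹ e)).symm

/-- Left multiplication by the row stabilizer of `𝔰` preserves the Murphy set. [folklore] -/
theorem mul_mem_murphyFinset {S T : StdFilling n μ.youngDiagram} {σ g : Perm (Fin n)} (hσ : σ ∈ rowStab S)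
    (hg : g ∈ murphyFinset S T) : σ * g ∈ murphyFinset S T := by
  rw [mem_murphyFinset] at hg ⊢
  intro e
  rw [Perm.mul_apply, (mem_rowStab_iff S σ).1 hσ, hg]

/-- `w_𝔰 w_𝔱⁻¹` lies in the Murphy set (it carries `𝔱` to `𝔰` cell by cell). [folklore] -/
theorem wordPerm_mul_inv_mem_murphyFinset (S T : StdFilling n μ.youngDiagram) :
    wordPerm S * (wordPerm T)⁻¹ ∈ murphyFinset S T := by
  simpa only [mul_one] using (conj_mem_murphyFinset_iff S T 1).2 (one_mem _)

/-- Murphy sets for non-row-equivalent `𝔰, 𝔰'` (and the same `𝔱`) are disjoint. [folklore] -/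
theorem disjoint_murphyFinset {S S' T : StdFilling n μ.youngDiagram} (h : ∃ e, (S.1 e).1 ≠ (S'.1 e).1) :
    Disjoint (murphyFinset S T) (murphyFinset S' T) := by
  rw [Finset.disjoint_left]
  intro g hg hg'
  rw [mem_murphyFinset] at hg hg'
  obtain ⟨e, he⟩ := h
  apply he
  have h1 := hg (g⁻¹ e)
  have h2 := hg' (g⁻¹ e)
  simp only [Perm.inv_def, Equiv.apply_symm_apply] at h1 h2
  rw [h1, h2]

/-- **Murphy elements `m_{𝔰𝔱}` with pairwise non-row-equivalent `𝔰` (and a fixed `𝔱`) are linearly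
independent** — their supports are disjoint and nonempty (the germ of "the permutation module
`M^λ` is free on tabloids"). [folklore] -/
theorem linearIndependent_murphy_of_pairwise [Nontrivial R] {ι : Type*} (S : ι → StdFilling n μ.youngDiagram)
    (T : StdFilling n μ.youngDiagram) (h : ∀ i j, i ≠ j → ∃ e, ((S i).1 e).1 ≠ ((S j).1 e).1) :
    LinearIndependent R fun i => murphy R (S i) T := by
  classical
  refine linearIndependent_iff'.2 fun s c hc i hi => ?_
  -- evaluate the coefficient at `w_{S i} w_T⁻¹`
  have key := congrArg (fun x : MonoidAlgebra R (Perm (Fin n)) => x.coeff (wordPerm (S i) * (wordPerm T)⁻¹)) hc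
  simp only [MonoidAlgebra.coeff_sum, MonoidAlgebra.coeff_smul, Finset.sum_apply', Finsupp.smul_apply, coeff_murphy,
    smul_eq_mul, mul_ite, mul_one, mul_zero, MonoidAlgebra.coeff_zero, Finsupp.zero_apply] at key
  rw [Finset.sum_eq_single i (fun j hj hji => ?_) (fun hi' => absurd hi hi')] at key
  · rwa [if_pos (wordPerm_mul_inv_mem_murphyFinset (S i) T)] at key
  · rw [if_neg]
    intro hmem
    exact Finset.disjoint_left.1 (disjoint_murphyFinset (h i j (Ne.symm hji))) (wordPerm_mul_inv_mem_murphyFinset (S i) T) hmem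

end MurphySet


/-! ### Dominance of (row classes of) tableaux -/

section Dominance

variable {n : ℕ}

/-- The number of entries `< k` lying in the rows `≤ i` of the tableau with growth sequence `f`
(for row-standard tableaux: the partial sums of the shape of the entries `< k`). [folklore] -/
def rowCount (f : Fin n → ℕ × ℕ) (k i : ℕ) : ℕ :=
  (Finset.univ.filter fun e : Fin n => (e : ℕ) < k ∧ (f e).1 ≤ i).card

/-- **Dominance** `f ⊵ g` of tableaux (through their rows only): every prefix of `f` has at least
as many entries in the top `i + 1` rows as the same prefix of `g` (the usual dominance order `⊵`
on row-standard tableaux, comparing the shapes of all prefixes). [folklore] -/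
def FillingDominates (f g : Fin n → ℕ × ℕ) : Prop :=
  ∀ k i : ℕ, rowCount g k i ≤ rowCount f k i

/-- Dominance is reflexive. [folklore] -/
theorem fillingDominates_refl (f : Fin n → ℕ × ℕ) : FillingDominates f f := fun _ _ => le_rfl

/-- Dominance is transitive. [folklore] -/
theorem FillingDominates.trans {f g h : Fin n → ℕ × ℕ} (h₁ : FillingDominates f g) (h₂ : FillingDominates g h) :
    FillingDominates f h := fun k i => (h₂ k i).trans (h₁ k i)

/-- The count grows by one exactly at the entries of the rows `≤ i`. [folklore] -/
theorem rowCount_succ (f : Fin n → ℕ × ℕ) (e : Fin n) (i : ℕ) :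
    rowCount f (e + 1) i = rowCount f e i + if (f e).1 ≤ i then 1 else 0 := by
  unfold rowCount
  have hsplit : (Finset.univ.filter fun e' : Fin n => (e' : ℕ) < e + 1 ∧ (f e').1 ≤ i) =
      (Finset.univ.filter fun e' : Fin n => (e' : ℕ) < e ∧ (f e').1 ≤ i) ∪
        (if (f e).1 ≤ i then {e} else ∅) := by
    ext e'
    simp only [Finset.mem_filter, Finset.mem_univ, true_and, Finset.mem_union]
    constructor
    · rintro ⟨h1, h2⟩
      rcases Nat.lt_succ_iff_lt_or_eq.1 h1 with h | h
      · exact Or.inl ⟨h, h2⟩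
      · right
        have : e' = e := Fin.ext h
        subst this
        rw [if_pos h2]; exact Finset.mem_singleton_self _
    · rintro (⟨h1, h2⟩ | h)
      · exact ⟨Nat.lt_succ_of_lt h1, h2⟩
      · split_ifs at h with hc
        · rw [Finset.mem_singleton] at h; subst h; exact ⟨Nat.lt_succ_self _, hc⟩
        · exact absurd h (Finset.notMem_empty _)
  rw [hsplit, Finset.card_union_of_disjoint]
  · split_ifs <;> simp
  · rw [Finset.disjoint_left]
    intro e' he' he''
    rw [Finset.mem_filter] at he'
    split_ifs at he'' with hc
    · rw [Finset.mem_singleton] at he''; subst he''; exact lt_irrefl _ he'.2.1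
    · exact absurd he'' (Finset.notMem_empty _)

/-- The row of an entry is read off from the counts. [folklore] -/
theorem row_le_iff_rowCount_lt (f : Fin n → ℕ × ℕ) (e : Fin n) (i : ℕ) :
    (f e).1 ≤ i ↔ rowCount f e i < rowCount f (e + 1) i := by
  rw [rowCount_succ]
  split_ifs with h
  · simp [h]
  · simp [h]

/-- Tableaux with the same counts are row equivalent. [folklore] -/
theorem row_eq_of_rowCount_eq {f g : Fin n → ℕ × ℕ} (h : ∀ k i, rowCount f k i = rowCount g k i) (e : Fin n) :
    (f e).1 = (g e).1 := by
  have key : ∀ i, (f e).1 ≤ i ↔ (g e).1 ≤ i := fun i => by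
    rw [row_le_iff_rowCount_lt, row_le_iff_rowCount_lt, h, h]
  exact le_antisymm ((key _).2 le_rfl) ((key _).1 le_rfl)

/-- **Dominance is antisymmetric on row classes.** [folklore] -/
theorem FillingDominates.row_eq {f g : Fin n → ℕ × ℕ} (h₁ : FillingDominates f g) (h₂ : FillingDominates g f)
    (e : Fin n) : (f e).1 = (g e).1 :=
  row_eq_of_rowCount_eq (fun k i => le_antisymm (h₂ k i) (h₁ k i)) e

/-- Row-equivalent tableaux have the same counts. [folklore] -/
theorem rowCount_congr {f g : Fin n → ℕ × ℕ} (h : ∀ e, (f e).1 = (g e).1) (k i : ℕ) :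
    rowCount f k i = rowCount g k i := by
  unfold rowCount
  congr 1
  ext e
  simp only [Finset.mem_filter, Finset.mem_univ, true_and, h e]

/-- The count as a sum of indicators, with two distinguished entries split off. [folklore] -/
theorem rowCount_eq_add_add (h : Fin n → ℕ × ℕ) {u v : Fin n} (huv : u ≠ v) (k i : ℕ) :
    rowCount h k i = (if (u : ℕ) < k ∧ (h u).1 ≤ i then 1 else 0) + (if (v : ℕ) < k ∧ (h v).1 ≤ i then 1 else 0) +
      ∑ e ∈ (Finset.univ.erase u).erase v, (if (e : ℕ) < k ∧ (h e).1 ≤ i then 1 else 0) := by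
  classical
  rw [rowCount, Finset.card_filter, ← Finset.add_sum_erase _ _ (Finset.mem_univ u),
    ← Finset.add_sum_erase _ _ (Finset.mem_erase.2 ⟨huv.symm, Finset.mem_univ v⟩), add_assoc]

/-- **The basic dominance move** (behind the row-Garnir straightening): if the smaller entry `u`
lies in a strictly lower row than the larger entry `v`, then exchanging the rows of `u` and `v`
gives a more dominant tableau. [folklore] -/
theorem fillingDominates_of_exchange {f g : Fin n → ℕ × ℕ} {u v : Fin n} (huv : u < v)
    (hrow : (f v).1 < (f u).1) (hu : (g u).1 = (f v).1) (hv : (g v).1 = (f u).1)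
    (hrest : ∀ e, e ≠ u → e ≠ v → (g e).1 = (f e).1) : FillingDominates g f := by
  intro k i
  have hne : u ≠ v := ne_of_lt huv
  have huv' : (u : ℕ) < v := Fin.lt_def.1 huv
  rw [rowCount_eq_add_add f hne, rowCount_eq_add_add g hne, hu, hv,
    Finset.sum_congr rfl (fun e he => by
      rw [Finset.mem_erase, Finset.mem_erase] at he
      rw [hrest e he.2.1 he.1] : ∀ e ∈ (Finset.univ.erase u).erase v,
        (if (e : ℕ) < k ∧ (g e).1 ≤ i then 1 else 0) = (if (e : ℕ) < k ∧ (f e).1 ≤ i then 1 else 0))]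
  have := hrow.le
  split_ifs <;> omega

/-- The move is strict: at the prefix `≤ u` and the row of `v` the count goes up. [folklore] -/
theorem rowCount_lt_of_exchange {f g : Fin n → ℕ × ℕ} {u v : Fin n} (huv : u < v)
    (hrow : (f v).1 < (f u).1) (hu : (g u).1 = (f v).1) (hv : (g v).1 = (f u).1)
    (hrest : ∀ e, e ≠ u → e ≠ v → (g e).1 = (f e).1) :
    rowCount f (u + 1) (f v).1 < rowCount g (u + 1) (f v).1 := by
  have hne : u ≠ v := ne_of_lt huv
  have huv' : (u : ℕ) < v := Fin.lt_def.1 huv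
  rw [rowCount_eq_add_add f hne, rowCount_eq_add_add g hne, hu, hv,
    Finset.sum_congr rfl (fun e he => by
      rw [Finset.mem_erase, Finset.mem_erase] at he
      rw [hrest e he.2.1 he.1] : ∀ e ∈ (Finset.univ.erase u).erase v,
        (if (e : ℕ) < (u : ℕ) + 1 ∧ (g e).1 ≤ (f v).1 then 1 else 0) =
          (if (e : ℕ) < (u : ℕ) + 1 ∧ (f e).1 ≤ (f v).1 then 1 else 0))]
  split_ifs <;> omega

end Dominance


/-! ### Young subgroups of set partitions of the entries and their sums `x_P` -/

section SetPartition

variable {n : ℕ}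

/-- The Young subgroup of the set partition of the entries with block labels `blk` (the
permutations preserving every block); `rowStabilizer λ` is the case `blk = rowOf`, `rowStab T`
the case `blk e = row of e in T`. [folklore] -/
def blockStab (blk : Fin n → ℕ) : Subgroup (Perm (Fin n)) where
  carrier := {σ | ∀ i, blk (σ i) = blk i}
  one_mem' := fun _ => rfl
  mul_mem' {σ τ} hσ hτ i := by rw [Perm.mul_apply, hσ, hτ]
  inv_mem' {σ} hσ i := by
    have := hσ (σ⁻¹ i)
    simp only [Perm.inv_def, Equiv.apply_symm_apply] at this ⊢
    exact this.symm

/-- Membership in a block stabilizer. [folklore] -/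
theorem mem_blockStab_iff (blk : Fin n → ℕ) (σ : Perm (Fin n)) : σ ∈ blockStab blk ↔ ∀ i, blk (σ i) = blk i :=
  Iff.rfl

/-- `S_λ` is the block stabilizer of `rowOf`. [folklore] -/
theorem rowStabilizer_eq_blockStab (μ : Nat.Partition n) : rowStabilizer μ = blockStab μ.rowOf := by
  ext σ; rfl

/-- `RowStab(T)` is the block stabilizer of the rows of `T`. [folklore] -/
theorem rowStab_eq_blockStab {μ : Nat.Partition n} (T : StdFilling n μ.youngDiagram) :
    rowStab T = blockStab fun e => (T.1 e).1 := by
  ext σ; rfl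

/-- **Conjugation of block stabilizers**: relabelling the entries by `π` conjugates the stabilizer,
`Stab(blk ∘ π⁻¹) = π Stab(blk) π⁻¹`. [folklore] -/
theorem mem_blockStab_comp_inv_iff (blk : Fin n → ℕ) (π σ : Perm (Fin n)) :
    σ ∈ blockStab (blk ∘ ⇑π⁻¹) ↔ π⁻¹ * σ * π ∈ blockStab blk := by
  simp only [mem_blockStab_iff, Function.comp_apply, Perm.mul_apply]
  constructor
  · intro h j
    simpa only [Perm.inv_def, Equiv.symm_apply_apply] using h (π j)
  · intro h i
    simpa only [Perm.inv_def, Equiv.apply_symm_apply] using h (π⁻¹ i)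

open scoped Classical in
/-- **`x_P = ∑_{σ ∈ S_P} σ`** for the set partition with block labels `blk`. [folklore] -/
def blockSum (blk : Fin n → ℕ) : MonoidAlgebra R (Perm (Fin n)) :=
  ∑ σ ∈ Finset.univ.filter (fun σ : Perm (Fin n) => σ ∈ blockStab blk), MonoidAlgebra.of R _ σ

/-- `x_λ` is the block sum of `rowOf`. [folklore] -/
theorem murphyX_eq_blockSum (μ : Nat.Partition n) : murphyX R μ = blockSum R μ.rowOf := by
  unfold murphyX blockSum
  rw [rowStabilizer_eq_blockStab]

open scoped Classical in
/-- **`x_{P ∘ π⁻¹} = π x_P π⁻¹`.** [folklore] -/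
theorem blockSum_comp_inv (blk : Fin n → ℕ) (π : Perm (Fin n)) :
    blockSum R (blk ∘ ⇑π⁻¹) = MonoidAlgebra.of R _ π * blockSum R blk * MonoidAlgebra.of R _ π⁻¹ := by
  unfold blockSum
  rw [Finset.mul_sum, Finset.sum_mul]
  simp_rw [← map_mul]
  refine Finset.sum_bij' (fun σ _ => π⁻¹ * σ * π) (fun σ _ => π * σ * π⁻¹) (fun σ hσ => ?_) (fun σ hσ => ?_)
    (fun σ _ => by group) (fun σ _ => by group) (fun σ _ => by congr 1; group)
  · rw [Finset.mem_filter] at hσ ⊢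
    exact ⟨Finset.mem_univ _, (mem_blockStab_comp_inv_iff blk π σ).1 hσ.2⟩
  · rw [Finset.mem_filter] at hσ ⊢
    refine ⟨Finset.mem_univ _, (mem_blockStab_comp_inv_iff blk π _).2 ?_⟩
    rw [show π⁻¹ * (π * σ * π⁻¹) * π = σ by group]
    exact hσ.2

/-- `π⁻¹ (π y) = y` in the group algebra. [folklore] -/
theorem of_inv_mul_of_mul (π : Perm (Fin n)) (y : MonoidAlgebra R (Perm (Fin n))) :
    MonoidAlgebra.of R _ π⁻¹ * (MonoidAlgebra.of R _ π * y) = y := by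
  rw [← mul_assoc, ← map_mul, inv_mul_cancel, map_one, one_mul]

/-- `π (π⁻¹ y) = y` in the group algebra. [folklore] -/
theorem of_mul_of_inv_mul (π : Perm (Fin n)) (y : MonoidAlgebra R (Perm (Fin n))) :
    MonoidAlgebra.of R _ π * (MonoidAlgebra.of R _ π⁻¹ * y) = y := by
  rw [← mul_assoc, ← map_mul, mul_inv_cancel, map_one, one_mul]

/-- **`x_{Row T} = w_T x_λ w_T⁻¹`**: the row-stabilizer sum of a tableau is conjugate to `x_λ`.
[folklore] -/
theorem blockSum_row_eq {μ : Nat.Partition n} (T : StdFilling n μ.youngDiagram) :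
    blockSum R (fun e => (T.1 e).1) =
      MonoidAlgebra.of R _ (wordPerm T) * murphyX R μ * MonoidAlgebra.of R _ (wordPerm T)⁻¹ := by
  rw [murphyX_eq_blockSum, ← blockSum_comp_inv]
  congr 1
  funext e
  exact row_eq_rowOf_wordPerm_inv T e

/-- `m_{𝔰𝔱} = x_{Row 𝔰} · (w_𝔰 w_𝔱⁻¹)`. [folklore] -/
theorem murphy_eq_blockSum_mul {μ : Nat.Partition n} (S T : StdFilling n μ.youngDiagram) :
    murphy R S T = blockSum R (fun e => (S.1 e).1) * MonoidAlgebra.of R _ (wordPerm S * (wordPerm T)⁻¹) := by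
  rw [blockSum_row_eq, murphy, map_mul]
  simp only [mul_assoc, of_inv_mul_of_mul]

/-- `m_{𝔰𝔱} = (w_𝔰 w_𝔱⁻¹) · x_{Row 𝔱}`. [folklore] -/
theorem murphy_eq_mul_blockSum {μ : Nat.Partition n} (S T : StdFilling n μ.youngDiagram) :
    murphy R S T = MonoidAlgebra.of R _ (wordPerm S * (wordPerm T)⁻¹) * blockSum R (fun e => (T.1 e).1) := by
  rw [blockSum_row_eq, murphy, map_mul]
  simp only [mul_assoc, of_inv_mul_of_mul]

end SetPartition


/-! ### Tabloids: the left ideal `H x_λ` is free on the row functions of the `λ`-tableaux -/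

section Tabloid

variable {n : ℕ} (μ : Nat.Partition n)

/-- **The row function of the tableau `h · 𝔱^λ`**: its entry `e` lies in the canonical row of
`h⁻¹ e` (a *tabloid* is a tableau up to row equivalence, i.e. such a row function). [folklore] -/
def rowFunOf (h : Perm (Fin n)) : Fin n → ℕ := fun e => μ.rowOf (h⁻¹ e)

/-- The row function of `h · 𝔱^λ` at an entry. [folklore] -/
theorem rowFunOf_apply (h : Perm (Fin n)) (e : Fin n) : rowFunOf μ h e = μ.rowOf (h⁻¹ e) := rfl

/-- `(g h) · 𝔱^λ` has the row function of `h · 𝔱^λ` transported by `g`. [folklore] -/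
theorem rowFunOf_mul (g h : Perm (Fin n)) : rowFunOf μ (g * h) = rowFunOf μ h ∘ ⇑g⁻¹ := by
  funext e
  simp only [rowFunOf_apply, Function.comp_apply, mul_inv_rev, Perm.mul_apply]

/-- Two permutations give the same tabloid iff they lie in the same left coset of `S_λ`. [folklore] -/
theorem rowFunOf_eq_iff (g h : Perm (Fin n)) : rowFunOf μ g = rowFunOf μ h ↔ g⁻¹ * h ∈ rowStabilizer μ := by
  rw [inv_mul_mem_rowStabilizer_iff]
  simp only [rowReading_apply, funext_iff, rowFunOf_apply]

/-- The row function of `w_T · 𝔱^λ = T` is the row function of `T`. [folklore] -/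
theorem rowFunOf_wordPerm {μ : Nat.Partition n} (T : StdFilling n μ.youngDiagram) :
    rowFunOf μ (wordPerm T) = fun e => (T.1 e).1 := by
  funext e
  rw [rowFunOf_apply, row_eq_rowOf_wordPerm_inv]

/-- `𝔱^λ` itself (`h = 1`) has the row function `rowOf`. [folklore] -/
theorem rowFunOf_one : rowFunOf μ 1 = μ.rowOf := by
  funext e; rw [rowFunOf_apply, inv_one, Perm.one_apply]

open scoped Classical in
/-- **The tabloid element** of a row function `r`: the sum of all `h` with `h · 𝔱^λ` of row
function `r` (zero unless `r` is the row function of a `λ`-tableau); for `r = ` rows of `T` this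
is `w_T x_λ = m_{T 𝔱^λ}`. [folklore] -/
def tabloidSum (r : Fin n → ℕ) : MonoidAlgebra R (Perm (Fin n)) :=
  ∑ h ∈ Finset.univ.filter (fun h : Perm (Fin n) => rowFunOf μ h = r), MonoidAlgebra.of R _ h

open scoped Classical in
/-- **`tabloidSum (rows of g · 𝔱^λ) = g x_λ`.** [folklore] -/
theorem tabloidSum_rowFunOf (g : Perm (Fin n)) : tabloidSum R μ (rowFunOf μ g) = MonoidAlgebra.of R _ g * murphyX R μ := by
  unfold tabloidSum murphyX
  rw [Finset.mul_sum]
  simp_rw [← map_mul]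
  refine Finset.sum_bij' (fun h _ => g⁻¹ * h) (fun σ _ => g * σ) (fun h hh => ?_) (fun σ hσ => ?_)
    (fun h _ => by group) (fun σ _ => by group) (fun h _ => by congr 1; group)
  · rw [Finset.mem_filter] at hh ⊢
    exact ⟨Finset.mem_univ _, (rowFunOf_eq_iff μ g h).1 hh.2.symm⟩
  · rw [Finset.mem_filter] at hσ ⊢
    refine ⟨Finset.mem_univ _, ((rowFunOf_eq_iff μ g (g * σ)).2 ?_).symm⟩
    rw [inv_mul_cancel_left]; exact hσ.2

/-- `tabloidSum rowOf = x_λ`. [folklore] -/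
theorem tabloidSum_rowOf : tabloidSum R μ μ.rowOf = murphyX R μ := by
  rw [← rowFunOf_one, tabloidSum_rowFunOf, map_one, one_mul]

/-- `m_{T 𝔱^λ} = tabloidSum (rows of T) = w_T x_λ`. [folklore] -/
theorem murphy_rowReading_right {μ : Nat.Partition n} (T : StdFilling n μ.youngDiagram) :
    murphy R T (rowReading μ) = tabloidSum R μ (fun e => (T.1 e).1) := by
  rw [← rowFunOf_wordPerm, tabloidSum_rowFunOf, murphy, wordPerm_rowReading, inv_one, map_one, mul_one]

open scoped Classical in
/-- Row functions that are not realised give `0`. [folklore] -/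
theorem tabloidSum_eq_zero {r : Fin n → ℕ} (hr : ∀ g : Perm (Fin n), rowFunOf μ g ≠ r) : tabloidSum R μ r = 0 := by
  unfold tabloidSum
  rw [Finset.filter_eq_empty_iff.2 fun g _ => hr g, Finset.sum_empty]

open scoped Classical in
/-- **`g · f(𝔱) = f(g · 𝔱)`**: left multiplication transports the row function. [folklore] -/
theorem of_mul_tabloidSum (g : Perm (Fin n)) (r : Fin n → ℕ) :
    MonoidAlgebra.of R _ g * tabloidSum R μ r = tabloidSum R μ (r ∘ ⇑g⁻¹) := by
  unfold tabloidSum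
  rw [Finset.mul_sum]
  simp_rw [← map_mul]
  refine Finset.sum_bij' (fun h _ => g * h) (fun h _ => g⁻¹ * h) (fun h hh => ?_) (fun h hh => ?_)
    (fun h _ => by group) (fun h _ => by group) (fun h _ => rfl)
  · rw [Finset.mem_filter] at hh ⊢
    exact ⟨Finset.mem_univ _, by rw [rowFunOf_mul, hh.2]⟩
  · rw [Finset.mem_filter] at hh ⊢
    refine ⟨Finset.mem_univ _, ?_⟩
    have := hh.2
    rw [show h = g * (g⁻¹ * h) by group, rowFunOf_mul] at this
    -- cancel the transport by `g`
    funext e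
    have he := congrFun this (g e)
    simp only [Function.comp_apply, Perm.inv_def, Equiv.symm_apply_apply] at he
    exact he

open scoped Classical in
/-- The coefficients of a tabloid element. [folklore] -/
theorem coeff_tabloidSum (r : Fin n → ℕ) (g : Perm (Fin n)) :
    (tabloidSum R μ r).coeff g = if rowFunOf μ g = r then 1 else 0 := by
  unfold tabloidSum
  rw [MonoidAlgebra.coeff_sum, Finset.sum_apply']
  simp only [MonoidAlgebra.of_apply, MonoidAlgebra.coeff_single, Finsupp.single_apply]
  rw [Finset.sum_ite_eq' _ g]
  exact if_congr (by rw [Finset.mem_filter, and_iff_right (Finset.mem_univ g)]) rfl rfl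

open scoped Classical in
/-- **A sum of tabloid elements over a set of row functions is the sum of all `h` whose tabloid lies
in the set** (the fibres of `h ↦ rows of h · 𝔱^λ` are the left cosets of `S_λ`). [folklore] -/
theorem sum_tabloidSum (𝒯 : Finset (Fin n → ℕ)) :
    ∑ r ∈ 𝒯, tabloidSum R μ r =
      ∑ h ∈ Finset.univ.filter (fun h : Perm (Fin n) => rowFunOf μ h ∈ 𝒯), MonoidAlgebra.of R _ h := by
  unfold tabloidSum
  rw [← Finset.sum_fiberwise_of_maps_to (s := Finset.univ.filter fun h : Perm (Fin n) => rowFunOf μ h ∈ 𝒯) (t := 𝒯)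
    (g := rowFunOf μ) (fun h hh => (Finset.mem_filter.1 hh).2)]
  refine Finset.sum_congr rfl fun r hr => Finset.sum_congr ?_ fun _ _ => rfl
  ext h
  simp only [Finset.mem_filter, Finset.mem_univ, true_and]
  constructor
  · intro hh; exact ⟨hh ▸ hr, hh⟩
  · exact fun hh => hh.2

/-- **`H x_λ` is free on tabloids**: tabloid elements of distinct realised row functions are
linearly independent (disjoint supports). [folklore] -/
theorem linearIndependent_tabloidSum [Nontrivial R] :
    LinearIndependent R fun r : {r : Fin n → ℕ // ∃ g : Perm (Fin n), rowFunOf μ g = r} => tabloidSum R μ r.1 := by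
  classical
  refine linearIndependent_iff'.2 fun s c hc r hr => ?_
  obtain ⟨g, hg⟩ := r.2
  have key := congrArg (fun x : MonoidAlgebra R (Perm (Fin n)) => x.coeff g) hc
  simp only [MonoidAlgebra.coeff_sum, MonoidAlgebra.coeff_smul, Finset.sum_apply', Finsupp.smul_apply, coeff_tabloidSum,
    smul_eq_mul, mul_ite, mul_one, mul_zero, MonoidAlgebra.coeff_zero, Finsupp.zero_apply] at key
  rw [Finset.sum_eq_single r (fun r' _ hr' => ?_) (fun hr' => absurd hr hr')] at key
  · rwa [if_pos hg] at key
  · rw [if_neg]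
    intro h'
    exact hr' (Subtype.ext (h'.symm.trans hg))

end Tabloid


/-! ### Inclusion–exclusion over a forbidden set (layer L2 of the straightening plan) -/

section InclusionExclusion

/-- **Inclusion–exclusion**: summing `φ` over the members of `P` disjoint from `U` equals the
alternating sum, over `U₀ ⊆ U`, of the sums of `φ` over the members of `P` containing `U₀`
(`∑_{U₀ ⊆ U ∩ B} (-1)^{|U₀|} = [U ∩ B = ∅]`). This rewrites the row-Garnir element as a signed
sum of orbit sums of enlarged Young subgroups. [folklore] -/
theorem sum_filter_disjoint_eq_sum_powerset {α M : Type*} [DecidableEq α] [AddCommGroup M]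
    (P : Finset (Finset α)) (U : Finset α) (φ : Finset α → M) :
    ∑ B ∈ P.filter (fun B => Disjoint U B), φ B =
      ∑ U₀ ∈ U.powerset, ((-1 : ℤ) ^ U₀.card) • ∑ B ∈ P.filter (fun B => U₀ ⊆ B), φ B := by
  -- exchange the sums and evaluate the inner alternating sum
  have inner : ∀ B : Finset α, (∑ U₀ ∈ U.powerset.filter (fun U₀ => U₀ ⊆ B), (-1 : ℤ) ^ U₀.card) =
      if Disjoint U B then 1 else 0 := by
    intro B
    have hset : U.powerset.filter (fun U₀ => U₀ ⊆ B) = (U ∩ B).powerset := by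
      ext U₀
      simp only [Finset.mem_filter, Finset.mem_powerset, Finset.subset_inter_iff]
    rw [hset, Finset.sum_powerset_neg_one_pow_card]
    exact if_congr Finset.disjoint_iff_inter_eq_empty.symm rfl rfl
  calc ∑ B ∈ P.filter (fun B => Disjoint U B), φ B
      = ∑ B ∈ P, (if Disjoint U B then (1 : ℤ) else 0) • φ B := by
        rw [Finset.sum_filter]
        refine Finset.sum_congr rfl fun B _ => ?_
        split_ifs <;> simp
    _ = ∑ B ∈ P, (∑ U₀ ∈ U.powerset.filter (fun U₀ => U₀ ⊆ B), (-1 : ℤ) ^ U₀.card) • φ B := by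
        simp_rw [inner]
    _ = ∑ B ∈ P, ∑ U₀ ∈ U.powerset, (if U₀ ⊆ B then ((-1 : ℤ) ^ U₀.card) • φ B else 0) := by
        refine Finset.sum_congr rfl fun B _ => ?_
        rw [Finset.sum_filter, Finset.sum_smul]
        refine Finset.sum_congr rfl fun U₀ _ => ?_
        split_ifs <;> simp
    _ = ∑ U₀ ∈ U.powerset, ∑ B ∈ P, (if U₀ ⊆ B then ((-1 : ℤ) ^ U₀.card) • φ B else 0) := Finset.sum_comm
    _ = ∑ U₀ ∈ U.powerset, ((-1 : ℤ) ^ U₀.card) • ∑ B ∈ P.filter (fun B => U₀ ⊆ B), φ B := by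
        refine Finset.sum_congr rfl fun U₀ _ => ?_
        rw [Finset.sum_filter, Finset.smul_sum]
        refine Finset.sum_congr rfl fun B _ => ?_
        split_ifs <;> simp

end InclusionExclusion


/-! ### Sums over left-stable sets of permutations are multiples of `x_Q` (layer L3) -/

section Stable

variable {n : ℕ}

open scoped Classical in
/-- The right coset `Q k` as a finset. [folklore] -/
theorem sum_image_mul_right (blk : Fin n → ℕ) (k : Perm (Fin n)) :
    ∑ h ∈ (Finset.univ.filter fun q : Perm (Fin n) => q ∈ blockStab blk).image (· * k), MonoidAlgebra.of R _ h =
      blockSum R blk * MonoidAlgebra.of R _ k := by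
  rw [Finset.sum_image (fun q _ q' _ h => mul_right_cancel h), blockSum, Finset.sum_mul]
  simp_rw [← map_mul]

open scoped Classical in
/-- **A sum of group elements over a set stable under left multiplication by the Young subgroup
`S_Q` is a left multiple of `x_Q`** (decompose into right cosets). [folklore] -/
theorem exists_sum_eq_blockSum_mul (blk : Fin n → ℕ) (A : Finset (Perm (Fin n)))
    (hA : ∀ q ∈ blockStab blk, ∀ h ∈ A, q * h ∈ A) :
    ∃ z : MonoidAlgebra R (Perm (Fin n)), ∑ h ∈ A, MonoidAlgebra.of R _ h = blockSum R blk * z := by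
  induction hcard : A.card using Nat.strong_induction_on generalizing A with
  | _ N ih =>
    rcases A.eq_empty_or_nonempty with rfl | ⟨k, hk⟩
    · exact ⟨0, by simp⟩
    · -- split off the right coset of `k`
      set C := (Finset.univ.filter fun q : Perm (Fin n) => q ∈ blockStab blk).image (· * k) with hC
      have hCA : C ⊆ A := by
        intro h hh
        rw [hC, Finset.mem_image] at hh
        obtain ⟨q, hq, rfl⟩ := hh
        exact hA q (Finset.mem_filter.1 hq).2 k hk
      have hkC : k ∈ C := by
        rw [hC, Finset.mem_image]
        exact ⟨1, Finset.mem_filter.2 ⟨Finset.mem_univ _, one_mem _⟩, one_mul k⟩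
      have hCstab : ∀ q ∈ blockStab blk, ∀ h ∈ C, q * h ∈ C := by
        intro q hq h hh
        rw [hC, Finset.mem_image] at hh ⊢
        obtain ⟨q', hq', rfl⟩ := hh
        exact ⟨q * q', Finset.mem_filter.2 ⟨Finset.mem_univ _, mul_mem hq (Finset.mem_filter.1 hq').2⟩, (mul_assoc _ _ _).symm⟩
      have hrest : ∀ q ∈ blockStab blk, ∀ h ∈ A \ C, q * h ∈ A \ C := by
        intro q hq h hh
        rw [Finset.mem_sdiff] at hh ⊢
        refine ⟨hA q hq h hh.1, fun hqh => hh.2 ?_⟩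
        have := hCstab q⁻¹ (inv_mem hq) _ hqh
        rwa [inv_mul_cancel_left] at this
      have hlt : (A \ C).card < N := by
        rw [← hcard, Finset.card_sdiff_of_subset hCA]
        have h1 : 0 < C.card := Finset.card_pos.2 ⟨k, hkC⟩
        have h2 : C.card ≤ A.card := Finset.card_le_card hCA
        omega
      obtain ⟨z', hz'⟩ := ih _ hlt (A \ C) hrest rfl
      refine ⟨MonoidAlgebra.of R _ k + z', ?_⟩
      rw [← Finset.sum_sdiff hCA, hz', sum_image_mul_right, mul_add, add_comm]

open scoped Classical in
/-- **Orbit sums of tabloids are multiples of `x_Q`**: if a set of row functions is stable under a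
Young subgroup `S_Q` (acting by `r ↦ r ∘ q⁻¹`), the sum of its tabloid elements lies in `x_Q H`.
This is the term `N(U₀)` of the row-Garnir straightening. [folklore] -/
theorem exists_sum_tabloidSum_eq_blockSum_mul (μ : Nat.Partition n) (blk : Fin n → ℕ) (O : Finset (Fin n → ℕ))
    (hO : ∀ q ∈ blockStab blk, ∀ r ∈ O, r ∘ ⇑q⁻¹ ∈ O) :
    ∃ z : MonoidAlgebra R (Perm (Fin n)), ∑ r ∈ O, tabloidSum R μ r = blockSum R blk * z := by
  rw [sum_tabloidSum]
  refine exists_sum_eq_blockSum_mul R blk _ fun q hq h hh => ?_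
  rw [Finset.mem_filter] at hh ⊢
  exact ⟨Finset.mem_univ _, by rw [rowFunOf_mul]; exact hO q hq _ hh.2⟩

end Stable


/-! ### Labellings with the same block sizes are conjugate; the quadratic type measure `Φ` (layer L4) -/

section Conjugacy

variable {n : ℕ}

/-- The size of the block with label `b`. [folklore] -/
def blockSize (blk : Fin n → ℕ) (b : ℕ) : ℕ := (Finset.univ.filter fun i : Fin n => blk i = b).card

/-- **Young subgroups of set partitions with the same block sizes (label by label) are conjugate**:
there is `π` with `blk ∘ π = blk'` (match the blocks fibrewise, `Equiv.ofFiberEquiv`). [folklore] -/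
theorem exists_perm_comp_eq (blk blk' : Fin n → ℕ) (h : ∀ b, blockSize blk b = blockSize blk' b) :
    ∃ π : Perm (Fin n), blk ∘ ⇑π = blk' := by
  classical
  have e : ∀ b : ℕ, {i : Fin n // blk' i = b} ≃ {i : Fin n // blk i = b} := fun b =>
    Fintype.equivOfCardEq (by
      rw [Fintype.card_subtype, Fintype.card_subtype]
      exact (h b).symm)
  exact ⟨Equiv.ofFiberEquiv e, funext fun i => Equiv.ofFiberEquiv_map e i⟩

/-- Consequently their block sums are conjugate: `x_{blk'} = π⁻¹ x_{blk} π`. [folklore] -/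
theorem exists_blockSum_eq_conj (blk blk' : Fin n → ℕ) (h : ∀ b, blockSize blk b = blockSize blk' b) :
    ∃ π : Perm (Fin n), blockSum R blk' = MonoidAlgebra.of R _ π⁻¹ * blockSum R blk * MonoidAlgebra.of R _ π := by
  obtain ⟨π, hπ⟩ := exists_perm_comp_eq blk blk' h
  refine ⟨π, ?_⟩
  rw [← hπ, show (⇑π : Fin n → Fin n) = ⇑(π⁻¹)⁻¹ by rw [inv_inv], blockSum_comp_inv, inv_inv]

/-- Block sizes are invariant under relabelling the entries by a permutation. [folklore] -/
theorem blockSize_comp_perm (blk : Fin n → ℕ) (π : Perm (Fin n)) (b : ℕ) : blockSize (blk ∘ ⇑π) b = blockSize blk b := by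
  unfold blockSize
  refine Finset.card_bij (fun i _ => π i) (fun i hi => ?_) (fun i _ j _ hij => π.injective hij) (fun j hj => ?_)
  · rw [Finset.mem_filter] at hi ⊢; exact ⟨Finset.mem_univ _, hi.2⟩
  · rw [Finset.mem_filter] at hj
    exact ⟨π⁻¹ j, Finset.mem_filter.2 ⟨Finset.mem_univ _, by simp [hj.2]⟩, by simp⟩

end Conjugacy


/-! ### Dominance of labellings through column counts; the ideals `J^{▷Q}` (layer L4) -/

section ColCount

variable {n : ℕ}

/-- Labels that are not used have empty blocks. [folklore] -/
theorem blockSize_eq_zero_of_not_mem {blk : Fin n → ℕ} {b : ℕ} (hb : b ∉ Finset.univ.image blk) :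
    blockSize blk b = 0 := by
  rw [blockSize, Finset.card_eq_zero, Finset.filter_eq_empty_iff]
  intro i _ hi
  exact hb (Finset.mem_image.2 ⟨i, Finset.mem_univ _, hi⟩)

/-- A used label has a nonempty block. [folklore] -/
theorem blockSize_pos_of_mem {blk : Fin n → ℕ} {b : ℕ} (hb : b ∈ Finset.univ.image blk) : 0 < blockSize blk b := by
  rw [blockSize, Finset.card_pos]
  obtain ⟨i, -, hi⟩ := Finset.mem_image.1 hb
  exact ⟨i, Finset.mem_filter.2 ⟨Finset.mem_univ _, hi⟩⟩

/-- **The column count `C_t(Q) = ∑_{blocks b} min(|b|, t)`**: the number of cells in the first `t`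
columns of the Young diagram whose rows are the blocks of `Q` — the partial sums of the *conjugate*
type, so that `Q` dominates `Q'` iff `C_t(Q) ≤ C_t(Q')` for all `t`. This sort-free form of the
dominance order is the one used in the straightening. [folklore] -/
def colCount (blk : Fin n → ℕ) (t : ℕ) : ℕ :=
  ∑ b ∈ Finset.univ.image blk, min (blockSize blk b) t

/-- The column count may be summed over any set of labels containing the used ones. [folklore] -/
theorem colCount_eq_sum_of_subset (blk : Fin n → ℕ) {S : Finset ℕ} (hS : Finset.univ.image blk ⊆ S) (t : ℕ) :
    colCount blk t = ∑ b ∈ S, min (blockSize blk b) t := by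
  rw [colCount]
  refine Finset.sum_subset hS fun b _ hb => ?_
  rw [blockSize_eq_zero_of_not_mem hb, Nat.zero_min]

/-- The column counts only depend on the block sizes. [folklore] -/
theorem colCount_congr {blk blk' : Fin n → ℕ} (h : ∀ b, blockSize blk b = blockSize blk' b) :
    colCount blk = colCount blk' := by
  classical
  funext t
  rw [colCount_eq_sum_of_subset blk (Finset.subset_union_left (s₂ := Finset.univ.image blk')),
    colCount_eq_sum_of_subset blk' (Finset.subset_union_right (s₁ := Finset.univ.image blk))]
  simp_rw [h]

/-- Relabelling the entries by a permutation does not change the column counts. [folklore] -/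
theorem colCount_comp_perm (blk : Fin n → ℕ) (π : Perm (Fin n)) : colCount (blk ∘ ⇑π) = colCount blk :=
  colCount_congr (blockSize_comp_perm blk π)

/-- **Dominance `Q ⊵ Q'` of labellings** (of their types): `C_t(Q) ≤ C_t(Q')` for all `t`. [folklore] -/
def LabDom (blk blk' : Fin n → ℕ) : Prop := ∀ t, colCount blk t ≤ colCount blk' t

/-- **Strict dominance `Q ▷ Q'`.** [folklore] -/
def LabSDom (blk blk' : Fin n → ℕ) : Prop := LabDom blk blk' ∧ ∃ t, colCount blk t < colCount blk' t

/-- Dominance is reflexive. [folklore] -/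
theorem labDom_refl (blk : Fin n → ℕ) : LabDom blk blk := fun _ => le_rfl

/-- Dominance is transitive. [folklore] -/
theorem LabDom.trans {a b c : Fin n → ℕ} (h₁ : LabDom a b) (h₂ : LabDom b c) : LabDom a c :=
  fun t => (h₁ t).trans (h₂ t)

/-- Strict dominance is irreflexive. [folklore] -/
theorem labSDom_irrefl (blk : Fin n → ℕ) : ¬ LabSDom blk blk := fun h => by
  obtain ⟨t, ht⟩ := h.2; exact lt_irrefl _ ht

/-- Strict then weak dominance is strict. [folklore] -/
theorem LabSDom.trans_dom {a b c : Fin n → ℕ} (h₁ : LabSDom a b) (h₂ : LabDom b c) : LabSDom a c :=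
  ⟨h₁.1.trans h₂, by obtain ⟨t, ht⟩ := h₁.2; exact ⟨t, ht.trans_le (h₂ t)⟩⟩

/-- Weak then strict dominance is strict. [folklore] -/
theorem LabDom.trans_sdom {a b c : Fin n → ℕ} (h₁ : LabDom a b) (h₂ : LabSDom b c) : LabSDom a c :=
  ⟨h₁.trans h₂.1, by obtain ⟨t, ht⟩ := h₂.2; exact ⟨t, (h₁ t).trans_lt ht⟩⟩

/-- Strict dominance is transitive. [folklore] -/
theorem LabSDom.trans {a b c : Fin n → ℕ} (h₁ : LabSDom a b) (h₂ : LabSDom b c) : LabSDom a c :=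
  h₁.trans_dom h₂.1

/-- Labellings with the same column counts dominate the same labellings. [folklore] -/
theorem labSDom_congr_right {a b b' : Fin n → ℕ} (h : colCount b = colCount b') : LabSDom a b ↔ LabSDom a b' := by
  unfold LabSDom LabDom; rw [h]

/-- The arithmetic of a move: taking `m` boxes from a block of size `s₂` to a block of size
`s₁ ≥ s₂` does not increase any column count … [folklore] -/
theorem min_move_le (s₁ s₂ m t : ℕ) (h : s₂ ≤ s₁) (hm : m ≤ s₂) :
    min (s₁ + m) t + min (s₂ - m) t ≤ min s₁ t + min s₂ t := by
  omega

/-- … and strictly decreases the count at `t = s₂` when `m ≥ 1`. [folklore] -/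
theorem min_move_lt (s₁ s₂ m : ℕ) (h : s₂ ≤ s₁) (hm : m ≤ s₂) (hm1 : 1 ≤ m) :
    min (s₁ + m) s₂ + min (s₂ - m) s₂ < min s₁ s₂ + min s₂ s₂ := by
  omega

/-- A sum over a set of labels with two labels split off. [folklore] -/
theorem sum_eq_add_add_sum_erase {b₁ b₂ : ℕ} {S : Finset ℕ} (hb : b₁ ≠ b₂) (h₁ : b₁ ∈ S) (h₂ : b₂ ∈ S) (f : ℕ → ℕ) :
    ∑ b ∈ S, f b = f b₁ + f b₂ + ∑ b ∈ (S.erase b₁).erase b₂, f b := by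
  rw [← Finset.add_sum_erase _ _ h₁, ← Finset.add_sum_erase _ _ (Finset.mem_erase.2 ⟨hb.symm, h₂⟩), add_assoc]

/-- **The basic dominance move on types**: moving `m ≥ 1` entries from the block `b₂` to a block `b₁`
that is at least as large gives a strictly more dominant labelling (all row-Garnir terms arise from
`x_λ` this way). [folklore] -/
theorem labSDom_of_move {blk blk' : Fin n → ℕ} {b₁ b₂ : ℕ} (hb : b₁ ≠ b₂) {m : ℕ} (hm1 : 1 ≤ m)
    (hm : m ≤ blockSize blk b₂) (hle : blockSize blk b₂ ≤ blockSize blk b₁)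
    (h₁ : blockSize blk' b₁ = blockSize blk b₁ + m) (h₂ : blockSize blk' b₂ = blockSize blk b₂ - m)
    (hrest : ∀ b, b ≠ b₁ → b ≠ b₂ → blockSize blk' b = blockSize blk b) : LabSDom blk' blk := by
  classical
  set S : Finset ℕ := Finset.univ.image blk ∪ Finset.univ.image blk' ∪ {b₁, b₂} with hSdef
  have hS : Finset.univ.image blk ⊆ S := (Finset.subset_union_left).trans Finset.subset_union_left
  have hS' : Finset.univ.image blk' ⊆ S := (Finset.subset_union_right).trans Finset.subset_union_left
  have hb₁ : b₁ ∈ S := Finset.mem_union_right _ (by simp)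
  have hb₂ : b₂ ∈ S := Finset.mem_union_right _ (by simp)
  have key : ∀ t, colCount blk' t + (min (blockSize blk b₁) t + min (blockSize blk b₂) t) =
      colCount blk t + (min (blockSize blk b₁ + m) t + min (blockSize blk b₂ - m) t) := by
    intro t
    rw [colCount_eq_sum_of_subset blk hS, colCount_eq_sum_of_subset blk' hS',
      sum_eq_add_add_sum_erase hb hb₁ hb₂, sum_eq_add_add_sum_erase hb hb₁ hb₂, h₁, h₂,
      Finset.sum_congr rfl (fun b hmem => by
        rw [Finset.mem_erase, Finset.mem_erase] at hmem
        rw [hrest b hmem.2.1 hmem.1] : ∀ b ∈ (S.erase b₁).erase b₂,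
          min (blockSize blk' b) t = min (blockSize blk b) t)]
    ring
  refine ⟨fun t => ?_, ⟨blockSize blk b₂, ?_⟩⟩
  · have h1 := key t
    have h2 := min_move_le _ _ _ t hle hm
    omega
  · have h1 := key (blockSize blk b₂)
    have h2 := min_move_lt _ _ _ hle hm hm1
    omega

end ColCount


/-! ### The ideals `J^{▷Q}` spanned by the `g x_{Q'} h` with `Q' ▷ Q` -/

section DomIdeal

variable {n : ℕ}

/-- **`J^{▷Q₀}`**: the `R`-span of all `g · x_Q · h` (`g, h ∈ S_n`) over the labellings `Q` strictly
more dominant than `Q₀` — a two-sided ideal; for `Q₀` of type `λ` this is Murphy's `Ȟ^{▷λ}`, the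
span of the `m_{𝔲𝔳}` of shape `▷ λ` (once the standard basis theorem is available). [folklore] -/
def domIdeal (blk₀ : Fin n → ℕ) : Submodule R (MonoidAlgebra R (Perm (Fin n))) :=
  Submodule.span R {x | ∃ (g h : Perm (Fin n)) (Q : Fin n → ℕ), LabSDom Q blk₀ ∧
    x = MonoidAlgebra.of R _ g * blockSum R Q * MonoidAlgebra.of R _ h}

/-- The generators of `J^{▷Q₀}`. [folklore] -/
theorem conj_blockSum_mem_domIdeal {blk₀ Q : Fin n → ℕ} (hQ : LabSDom Q blk₀) (g h : Perm (Fin n)) :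
    MonoidAlgebra.of R _ g * blockSum R Q * MonoidAlgebra.of R _ h ∈ domIdeal R blk₀ :=
  Submodule.subset_span ⟨g, h, Q, hQ, rfl⟩

/-- `x_Q ∈ J^{▷Q₀}` for `Q ▷ Q₀`. [folklore] -/
theorem blockSum_mem_domIdeal {blk₀ Q : Fin n → ℕ} (hQ : LabSDom Q blk₀) : blockSum R Q ∈ domIdeal R blk₀ := by
  simpa only [map_one, one_mul, mul_one] using conj_blockSum_mem_domIdeal R hQ 1 1

/-- `J^{▷Q₀}` is stable under left multiplication by group elements. [folklore] -/
theorem of_mul_mem_domIdeal {blk₀ : Fin n → ℕ} (g : Perm (Fin n)) {x : MonoidAlgebra R (Perm (Fin n))}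
    (hx : x ∈ domIdeal R blk₀) : MonoidAlgebra.of R _ g * x ∈ domIdeal R blk₀ := by
  induction hx using Submodule.span_induction with
  | mem x hx =>
    obtain ⟨g', h, Q, hQ, rfl⟩ := hx
    rw [← mul_assoc, ← mul_assoc, ← map_mul, mul_assoc (MonoidAlgebra.of R _ (g * g'))]
    simpa only [mul_assoc] using conj_blockSum_mem_domIdeal R hQ (g * g') h
  | zero => rw [mul_zero]; exact Submodule.zero_mem _
  | add x y _ _ hx hy => rw [mul_add]; exact Submodule.add_mem _ hx hy
  | smul r x _ hx => rw [mul_smul_comm]; exact Submodule.smul_mem _ r hx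

/-- `J^{▷Q₀}` is stable under right multiplication by group elements. [folklore] -/
theorem mul_of_mem_domIdeal {blk₀ : Fin n → ℕ} (h : Perm (Fin n)) {x : MonoidAlgebra R (Perm (Fin n))}
    (hx : x ∈ domIdeal R blk₀) : x * MonoidAlgebra.of R _ h ∈ domIdeal R blk₀ := by
  induction hx using Submodule.span_induction with
  | mem x hx =>
    obtain ⟨g, h', Q, hQ, rfl⟩ := hx
    rw [mul_assoc, ← map_mul]
    exact conj_blockSum_mem_domIdeal R hQ g (h' * h)
  | zero => rw [zero_mul]; exact Submodule.zero_mem _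
  | add x y _ _ hx hy => rw [add_mul]; exact Submodule.add_mem _ hx hy
  | smul r x _ hx => rw [smul_mul_assoc]; exact Submodule.smul_mem _ r hx

/-- **`J^{▷Q₀}` is a left ideal.** [folklore] -/
theorem mul_mem_domIdeal_left {blk₀ : Fin n → ℕ} (y : MonoidAlgebra R (Perm (Fin n))) {x : MonoidAlgebra R (Perm (Fin n))}
    (hx : x ∈ domIdeal R blk₀) : y * x ∈ domIdeal R blk₀ := by
  induction y using MonoidAlgebra.induction_on with
  | hM g => exact of_mul_mem_domIdeal R g hx
  | hadd y z hy hz => rw [add_mul]; exact Submodule.add_mem _ hy hz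
  | hsmul r y hy => rw [smul_mul_assoc]; exact Submodule.smul_mem _ r hy

/-- **`J^{▷Q₀}` is a right ideal.** [folklore] -/
theorem mul_mem_domIdeal_right {blk₀ : Fin n → ℕ} {x : MonoidAlgebra R (Perm (Fin n))} (hx : x ∈ domIdeal R blk₀)
    (y : MonoidAlgebra R (Perm (Fin n))) : x * y ∈ domIdeal R blk₀ := by
  induction y using MonoidAlgebra.induction_on with
  | hM g => exact mul_of_mem_domIdeal R g hx
  | hadd y z hy hz => rw [mul_add]; exact Submodule.add_mem _ hy hz
  | hsmul r y hy => rw [mul_smul_comm]; exact Submodule.smul_mem _ r hy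

/-- **Monotonicity**: a more dominant labelling has a smaller ideal, `Q₀ ⊵ Q₁ ⇒ J^{▷Q₀} ⊆ J^{▷Q₁}`.
[folklore] -/
theorem domIdeal_mono {blk₀ blk₁ : Fin n → ℕ} (h : LabDom blk₀ blk₁) : domIdeal R blk₀ ≤ domIdeal R blk₁ := by
  refine Submodule.span_le.2 ?_
  rintro x ⟨g, h', Q, hQ, rfl⟩
  exact conj_blockSum_mem_domIdeal R (hQ.trans_dom h) g h'

/-- In particular `J^{▷Q} ⊆ J^{▷Q₀}` for `Q ▷ Q₀`. [folklore] -/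
theorem domIdeal_le_of_sdom {blk₀ Q : Fin n → ℕ} (h : LabSDom Q blk₀) : domIdeal R Q ≤ domIdeal R blk₀ :=
  domIdeal_mono R h.1

/-- `J^{▷Q₀}` only depends on the column counts (the type) of `Q₀`. [folklore] -/
theorem domIdeal_congr {blk₀ blk₁ : Fin n → ℕ} (h : colCount blk₀ = colCount blk₁) : domIdeal R blk₀ = domIdeal R blk₁ :=
  le_antisymm (domIdeal_mono R fun t => (congrFun h t).le) (domIdeal_mono R fun t => (congrFun h t).ge)

open scoped Classical in
/-- `x_Q* = x_Q` (`S_Q` is a subgroup). [folklore] -/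
theorem grpAlgStar_blockSum (blk : Fin n → ℕ) : grpAlgStar R (blockSum R blk) = blockSum R blk := by
  unfold blockSum
  rw [map_sum]
  simp_rw [grpAlgStar_of]
  refine Finset.sum_bij' (fun σ _ => σ⁻¹) (fun σ _ => σ⁻¹) (fun σ hσ => ?_) (fun σ hσ => ?_)
    (fun σ _ => inv_inv σ) (fun σ _ => inv_inv σ) (fun σ _ => rfl)
  · rw [Finset.mem_filter] at hσ ⊢; exact ⟨Finset.mem_univ _, inv_mem hσ.2⟩
  · rw [Finset.mem_filter] at hσ ⊢; exact ⟨Finset.mem_univ _, inv_mem hσ.2⟩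

/-- **`(J^{▷Q₀})* = J^{▷Q₀}`.** [folklore] -/
theorem grpAlgStar_mem_domIdeal {blk₀ : Fin n → ℕ} {x : MonoidAlgebra R (Perm (Fin n))} (hx : x ∈ domIdeal R blk₀) :
    grpAlgStar R x ∈ domIdeal R blk₀ := by
  induction hx using Submodule.span_induction with
  | mem x hx =>
    obtain ⟨g, h, Q, hQ, rfl⟩ := hx
    rw [grpAlgStar_mul, grpAlgStar_mul, grpAlgStar_of, grpAlgStar_of, grpAlgStar_blockSum, ← mul_assoc]
    exact conj_blockSum_mem_domIdeal R hQ _ _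
  | zero => rw [map_zero]; exact Submodule.zero_mem _
  | add x y _ _ hx hy => rw [map_add]; exact Submodule.add_mem _ hx hy
  | smul r x _ hx => rw [map_smul]; exact Submodule.smul_mem _ r hx

end DomIdeal


/-! ### The rows of the tableaux of shape `λ` have the sizes `λ_i` -/

section RowSizes

variable {n : ℕ} {μ : Nat.Partition n}

/-- The rows of a standard `λ`-tableau with all cells filled have `λ_i` entries. [folklore] -/
theorem blockSize_rows (T : StdFilling n μ.youngDiagram) (i : ℕ) :
    blockSize (fun e => (T.1 e).1) i = μ.youngDiagram.rowLen i := by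
  rw [blockSize, YoungDiagram.rowLen_eq_card]
  refine Finset.card_bij (fun e _ => T.1 e) (fun e he => ?_) (fun e _ e' _ h => T.injective h) (fun x hx => ?_)
  · rw [Finset.mem_filter] at he
    rw [YoungDiagram.mem_row_iff]
    exact ⟨T.mem e, he.2⟩
  · rw [YoungDiagram.mem_row_iff] at hx
    obtain ⟨e, he⟩ := T.exists_eq μ.card_cells_youngDiagram hx.1
    exact ⟨e, Finset.mem_filter.2 ⟨Finset.mem_univ _, by rw [he]; exact hx.2⟩, he⟩

variable (μ)

/-- The rows of `𝔱^λ` have `λ_i` entries. [folklore] -/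
theorem blockSize_rowOf (i : ℕ) : blockSize μ.rowOf i = μ.youngDiagram.rowLen i :=
  blockSize_rows (rowReading μ) i

/-- The rows of every `λ`-tabloid `h · 𝔱^λ` have `λ_i` entries. [folklore] -/
theorem blockSize_rowFunOf (h : Perm (Fin n)) (i : ℕ) : blockSize (rowFunOf μ h) i = μ.youngDiagram.rowLen i := by
  rw [show rowFunOf μ h = μ.rowOf ∘ ⇑h⁻¹ from rfl, blockSize_comp_perm, blockSize_rowOf]

/-- The column counts of a `λ`-tabloid are those of `λ`. [folklore] -/
theorem colCount_rowFunOf (h : Perm (Fin n)) : colCount (rowFunOf μ h) = colCount μ.rowOf :=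
  colCount_congr fun b => by rw [blockSize_rowFunOf, blockSize_rowOf]

variable {μ}

/-- The column counts of a standard `λ`-tableau are those of `λ`. [folklore] -/
theorem colCount_rows (T : StdFilling n μ.youngDiagram) : colCount (fun e => (T.1 e).1) = colCount μ.rowOf :=
  colCount_congr fun b => by rw [blockSize_rows, blockSize_rowOf]

variable (μ)

/-- The rows of a `λ`-tabloid are rows of `λ`, hence `< n` (for `n ≥ 1`). [folklore] -/
theorem rowFunOf_lt (h : Perm (Fin n)) (e : Fin n) : rowFunOf μ h e < n := by
  rw [rowFunOf_apply]
  have h1 := μ.rowOf_lt_length (h⁻¹ e)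
  have h2 : μ.sortedParts.length ≤ n := by
    have hsum := μ.sum_sortedParts
    have : ∀ l : List ℕ, (∀ a ∈ l, 0 < a) → l.length ≤ l.sum := by
      intro l hl
      induction l with
      | nil => simp
      | cons a l ih =>
        simp only [List.length_cons, List.sum_cons]
        have ha := hl a (by simp)
        have := ih fun b hb => hl b (by simp [hb])
        omega
    have := this μ.sortedParts fun a ha => μ.pos_of_mem_sortedParts ha
    omega
  omega

end RowSizes


/-! ### The row-Garnir element lies in `J^{▷λ}` (layer L4) -/

section Garnir

variable {n : ℕ}

/-- The entries of a given row of a row function. [folklore] -/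
def rowSet (r : Fin n → ℕ) (a : ℕ) : Finset (Fin n) := Finset.univ.filter fun e => r e = a

/-- Membership in a row. [folklore] -/
theorem mem_rowSet {r : Fin n → ℕ} {a : ℕ} {e : Fin n} : e ∈ rowSet r a ↔ r e = a := by
  rw [rowSet, Finset.mem_filter, and_iff_right (Finset.mem_univ _)]

/-- A row has `blockSize` entries. [folklore] -/
theorem card_rowSet (r : Fin n → ℕ) (a : ℕ) : (rowSet r a).card = blockSize r a := rfl

/-- **The Garnir row functions `r_B`**: inside the set `A` (a row `a` together with a part `Y` of a
lower row `b`) the entries of `B` go to row `b` and the others to row `a`; outside `A` nothing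
changes. [folklore] -/
def garnirFun (r : Fin n → ℕ) (a b : ℕ) (A B : Finset (Fin n)) : Fin n → ℕ :=
  fun e => if e ∈ A then (if e ∈ B then b else a) else r e

variable {r : Fin n → ℕ} {a b : ℕ} {A Y : Finset (Fin n)}

/-- The values of `r_B` on `A`. [folklore] -/
theorem garnirFun_of_mem {B : Finset (Fin n)} {e : Fin n} (he : e ∈ A) :
    garnirFun r a b A B e = if e ∈ B then b else a := if_pos he

/-- The values of `r_B` off `A`. [folklore] -/
theorem garnirFun_of_not_mem {B : Finset (Fin n)} {e : Fin n} (he : e ∉ A) : garnirFun r a b A B e = r e := if_neg he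

/-- `r_Y = r` when `A = row a ∪ Y`, `Y ⊆ row b`. [folklore] -/
theorem garnirFun_self (hA : A = rowSet r a ∪ Y) (hY : Y ⊆ rowSet r b) : garnirFun r a b A Y = r := by
  funext e
  by_cases he : e ∈ A
  · rw [garnirFun_of_mem he]
    split_ifs with heY
    · exact (mem_rowSet.1 (hY heY)).symm
    · rw [hA, Finset.mem_union] at he
      rcases he with he | he
      · exact (mem_rowSet.1 he).symm
      · exact absurd he heY
  · exact garnirFun_of_not_mem he

/-- `B ↦ r_B` is injective on the subsets of `A` (for `a ≠ b`). [folklore] -/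
theorem garnirFun_injOn (hab : a ≠ b) {B B' : Finset (Fin n)} (hB : B ⊆ A) (hB' : B' ⊆ A)
    (h : garnirFun r a b A B = garnirFun r a b A B') : B = B' := by
  ext e
  by_cases he : e ∈ A
  · have := congrFun h e
    rw [garnirFun_of_mem he, garnirFun_of_mem he] at this
    by_cases h1 : e ∈ B <;> by_cases h2 : e ∈ B' <;> simp_all
  · exact ⟨fun h1 => absurd (hB h1) he, fun h2 => absurd (hB' h2) he⟩

/-- The row-`a` block of `r_{U₀}` is `A ∖ U₀` (row `a` lies inside `A`). [folklore] -/
theorem garnirFun_eq_a_iff (hab : a ≠ b) (hA : rowSet r a ⊆ A) {U₀ : Finset (Fin n)} (e : Fin n) :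
    garnirFun r a b A U₀ e = a ↔ e ∈ A ∧ e ∉ U₀ := by
  by_cases he : e ∈ A
  · rw [garnirFun_of_mem he]
    split_ifs with h1
    · simp [hab.symm, h1]
    · simp [he, h1]
  · rw [garnirFun_of_not_mem he]
    simp only [he, false_and, iff_false]
    intro h
    exact he (hA (mem_rowSet.2 h))

/-- The row-`b` block of `r_{U₀}` is `U₀` together with the part of row `b` outside `A`. [folklore] -/
theorem garnirFun_eq_b_iff (hab : a ≠ b) {U₀ : Finset (Fin n)} (hU₀ : U₀ ⊆ A) (e : Fin n) :
    garnirFun r a b A U₀ e = b ↔ e ∈ U₀ ∨ (e ∉ A ∧ r e = b) := by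
  by_cases he : e ∈ A
  · rw [garnirFun_of_mem he]
    split_ifs with h1
    · simp [h1]
    · simp [he, h1, hab]
  · rw [garnirFun_of_not_mem he]
    simp only [he, not_false_eq_true, true_and]
    exact ⟨Or.inr, fun h => h.elim (fun h1 => absurd (hU₀ h1) he) id⟩

/-- **Stability of the Garnir orbit**: a permutation preserving the blocks of `r_{U₀}` carries
`r_B` (`U₀ ⊆ B ⊆ A`) to `r_{B'}` with `B' = U₀ ∪ q(B ∖ U₀)`. [folklore] -/
theorem garnirFun_comp_inv (hab : a ≠ b) (hA : rowSet r a ⊆ A) {U₀ B : Finset (Fin n)} (hU₀B : U₀ ⊆ B) (hB : B ⊆ A)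
    {q : Perm (Fin n)} (hq : q ∈ blockStab (garnirFun r a b A U₀)) :
    garnirFun r a b A B ∘ ⇑q⁻¹ = garnirFun r a b A (U₀ ∪ (B \ U₀).image q) := by
  classical
  have hU₀ : U₀ ⊆ A := hU₀B.trans hB
  funext e
  simp only [Function.comp_apply]
  -- `q⁻¹ e` and `e` lie in the same block of `r_{U₀}`
  have hsame : garnirFun r a b A U₀ (q⁻¹ e) = garnirFun r a b A U₀ e := by
    have := (mem_blockStab_iff _ _).1 hq (q⁻¹ e)
    simpa only [Perm.inv_def, Equiv.apply_symm_apply] using this.symm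
  have himg : e ∈ (B \ U₀).image q ↔ q⁻¹ e ∈ B \ U₀ := by
    rw [Finset.mem_image]
    constructor
    · rintro ⟨x, hx, rfl⟩; simpa using hx
    · intro h; exact ⟨q⁻¹ e, h, by simp⟩
  by_cases hea : garnirFun r a b A U₀ e = a
  · -- both in the block `A ∖ U₀`
    have he := (garnirFun_eq_a_iff hab hA e).1 hea
    have he' := (garnirFun_eq_a_iff hab hA (q⁻¹ e)).1 (hsame.trans hea)
    rw [garnirFun_of_mem he'.1, garnirFun_of_mem he.1]
    have : (q⁻¹ e ∈ B) ↔ e ∈ U₀ ∪ (B \ U₀).image q := by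
      rw [Finset.mem_union, himg, Finset.mem_sdiff]
      constructor
      · intro h; exact Or.inr ⟨h, he'.2⟩
      · rintro (h | h)
        · exact absurd h he.2
        · exact h.1
    by_cases h1 : q⁻¹ e ∈ B
    · rw [if_pos h1, if_pos (this.1 h1)]
    · rw [if_neg h1, if_neg (fun h2 => h1 (this.2 h2))]
  by_cases heb : garnirFun r a b A U₀ e = b
  · -- both in the block `U₀ ∪ V`
    have he := (garnirFun_eq_b_iff hab hU₀ e).1 heb
    have he' := (garnirFun_eq_b_iff hab hU₀ (q⁻¹ e)).1 (hsame.trans heb)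
    have lhs : garnirFun r a b A B (q⁻¹ e) = b := by
      rcases he' with h1 | ⟨h1, h2⟩
      · rw [garnirFun_of_mem (hU₀ h1), if_pos (hU₀B h1)]
      · rw [garnirFun_of_not_mem h1, h2]
    have rhs : garnirFun r a b A (U₀ ∪ (B \ U₀).image q) e = b := by
      rcases he with h1 | ⟨h1, h2⟩
      · rw [garnirFun_of_mem (hU₀ h1), if_pos (Finset.mem_union_left _ h1)]
      · rw [garnirFun_of_not_mem h1, h2]
    rw [lhs, rhs]
  · -- both outside `A`
    have he : e ∉ A := fun he => by
      rw [garnirFun_of_mem he] at hea heb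
      split_ifs at hea heb <;> simp_all
    have he' : q⁻¹ e ∉ A := fun he' => by
      have h := hsame
      rw [garnirFun_of_mem he'] at h
      split_ifs at h with h1
      · exact heb h.symm
      · exact hea h.symm
    rw [garnirFun_of_not_mem he', garnirFun_of_not_mem he]
    have := hsame
    rwa [garnirFun_of_not_mem he', garnirFun_of_not_mem he] at this

/-- The transported set again contains `U₀`, lies in `A`, and has the same size. [folklore] -/
theorem garnir_image_mem (hab : a ≠ b) (hA : rowSet r a ⊆ A) {U₀ B : Finset (Fin n)} (hU₀B : U₀ ⊆ B) (hB : B ⊆ A)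
    {q : Perm (Fin n)} (hq : q ∈ blockStab (garnirFun r a b A U₀)) :
    U₀ ⊆ U₀ ∪ (B \ U₀).image q ∧ U₀ ∪ (B \ U₀).image q ⊆ A ∧ (U₀ ∪ (B \ U₀).image q).card = B.card := by
  classical
  have hU₀ : U₀ ⊆ A := hU₀B.trans hB
  -- `q` preserves the block `A ∖ U₀`
  have hpres : ∀ x, x ∈ A ∧ x ∉ U₀ → q x ∈ A ∧ q x ∉ U₀ := by
    intro x hx
    have h1 := (garnirFun_eq_a_iff hab hA x).2 hx
    have h2 : garnirFun r a b A U₀ (q x) = garnirFun r a b A U₀ x := (mem_blockStab_iff _ _).1 hq x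
    exact (garnirFun_eq_a_iff hab hA (q x)).1 (h2.trans h1)
  have himgA : (B \ U₀).image q ⊆ A \ U₀ := by
    intro y hy
    rw [Finset.mem_image] at hy
    obtain ⟨x, hx, rfl⟩ := hy
    rw [Finset.mem_sdiff] at hx ⊢
    exact hpres x ⟨hB hx.1, hx.2⟩
  refine ⟨Finset.subset_union_left, Finset.union_subset hU₀ (himgA.trans Finset.sdiff_subset), ?_⟩
  rw [Finset.card_union_of_disjoint, Finset.card_image_of_injective _ q.injective, Finset.card_sdiff_of_subset hU₀B]
  · have := Finset.card_le_card hU₀B; omega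
  · rw [Finset.disjoint_left]
    intro x hx hx'
    exact (Finset.mem_sdiff.1 (himgA hx')).2 hx

open scoped Classical in
/-- **The terms `N(U₀)` of the row-Garnir element lie in `J^{▷λ}`**: the sum of the tabloid
elements `f(r_B)` over the `B ⊇ U₀` of a fixed size is an orbit sum for the Young subgroup of
`r_{U₀}`, hence a multiple of `x_{r_{U₀}}`, and `r_{U₀} ▷ r`. [folklore] -/
theorem sum_tabloidSum_garnir_supset_mem (μ : Nat.Partition n) (hab : a ≠ b) (hA : rowSet r a ⊆ A)
    {U₀ : Finset (Fin n)} (k : ℕ) (hdom : LabSDom (garnirFun r a b A U₀) r) :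
    ∑ B ∈ (A.powersetCard k).filter (fun B => U₀ ⊆ B), tabloidSum R μ (garnirFun r a b A B) ∈ domIdeal R r := by
  set P := (A.powersetCard k).filter (fun B => U₀ ⊆ B) with hP
  have hmemP : ∀ {B}, B ∈ P ↔ B ⊆ A ∧ B.card = k ∧ U₀ ⊆ B := by
    intro B; rw [hP, Finset.mem_filter, Finset.mem_powersetCard, and_assoc]
  -- rewrite as a sum over the orbit of row functions
  have hinj : Set.InjOn (garnirFun r a b A) P := by
    intro B hB B' hB' h
    exact garnirFun_injOn hab (hmemP.1 hB).1 (hmemP.1 hB').1 h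
  rw [← Finset.sum_image hinj]
  obtain ⟨z, hz⟩ := exists_sum_tabloidSum_eq_blockSum_mul R μ (garnirFun r a b A U₀) (P.image (garnirFun r a b A)) (by
    intro q hq ρ hρ
    rw [Finset.mem_image] at hρ ⊢
    obtain ⟨B, hB, rfl⟩ := hρ
    obtain ⟨h1, h2, h3⟩ := hmemP.1 hB
    obtain ⟨m1, m2, m3⟩ := garnir_image_mem hab hA h3 h1 hq
    exact ⟨_, hmemP.2 ⟨m2, m3.trans h2, m1⟩, (garnirFun_comp_inv hab hA h3 h1 hq).symm⟩)
  rw [hz]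
  exact mul_mem_domIdeal_right R (blockSum_mem_domIdeal R hdom) z

/-- **The type of `r_{U₀}` strictly dominates that of `r`**: it arises from the rows of `r` by moving
`|Y| - |U₀| ≥ 1` entries from row `b` up to the row `a`, which is at least as long. [folklore] -/
theorem labSDom_garnirFun (hab : a ≠ b) (hA : A = rowSet r a ∪ Y) (hY : Y ⊆ rowSet r b) {U₀ : Finset (Fin n)}
    (hU₀ : U₀ ⊆ rowSet r a) (hlt : U₀.card < Y.card) (hsize : blockSize r b ≤ blockSize r a) :
    LabSDom (garnirFun r a b A U₀) r := by
  classical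
  have hU₀A : U₀ ⊆ A := by rw [hA]; exact hU₀.trans Finset.subset_union_left
  have hrowA : rowSet r a ⊆ A := by rw [hA]; exact Finset.subset_union_left
  have hdisj : Disjoint (rowSet r a) Y := by
    rw [Finset.disjoint_left]
    intro e he heY
    exact hab ((mem_rowSet.1 he).symm.trans (mem_rowSet.1 (hY heY)))
  have hYle : Y.card ≤ blockSize r b := by rw [← card_rowSet]; exact Finset.card_le_card hY
  have hcardA : A.card = blockSize r a + Y.card := by rw [hA, Finset.card_union_of_disjoint hdisj, card_rowSet]
  -- the block sizes of `r_{U₀}`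
  have hsz : ∀ c, blockSize (garnirFun r a b A U₀) c =
      if c = a then blockSize r a + (Y.card - U₀.card) else if c = b then blockSize r b - (Y.card - U₀.card) else blockSize r c := by
    intro c
    rw [blockSize]
    split_ifs with hca hcb
    · subst hca
      rw [show (Finset.univ.filter fun i => garnirFun r c b A U₀ i = c) = A \ U₀ by
        ext e; rw [Finset.mem_filter, and_iff_right (Finset.mem_univ _), garnirFun_eq_a_iff hab hrowA, Finset.mem_sdiff],
        Finset.card_sdiff_of_subset hU₀A, hcardA]
      have := Finset.card_le_card hU₀; rw [card_rowSet] at this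
      omega
    · subst hcb
      rw [show (Finset.univ.filter fun i => garnirFun r a c A U₀ i = c) = U₀ ∪ (rowSet r c \ Y) by
        ext e
        rw [Finset.mem_filter, and_iff_right (Finset.mem_univ _), garnirFun_eq_b_iff hab hU₀A, Finset.mem_union,
          Finset.mem_sdiff, mem_rowSet, hA, Finset.mem_union, not_or, mem_rowSet]
        constructor
        · rintro (h | ⟨⟨-, h2⟩, h3⟩); · exact Or.inl h
          exact Or.inr ⟨h3, h2⟩
        · rintro (h | ⟨h1, h2⟩); · exact Or.inl h
          exact Or.inr ⟨⟨fun h3 => hab (h3.symm.trans h1), h2⟩, h1⟩,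
        Finset.card_union_of_disjoint (Finset.disjoint_left.2 fun e he he' => by
          rw [Finset.mem_sdiff, mem_rowSet] at he'
          exact hab ((mem_rowSet.1 (hU₀ he)).symm.trans he'.1)),
        Finset.card_sdiff_of_subset hY, card_rowSet]
      omega
    · congr 1
      ext e
      rw [Finset.mem_filter, Finset.mem_filter, and_congr_right_iff]
      intro
      by_cases he : e ∈ A
      · rw [garnirFun_of_mem he]
        have hre : r e = a ∨ r e = b := by
          rw [hA, Finset.mem_union] at he
          exact he.imp mem_rowSet.1 (fun h => mem_rowSet.1 (hY h))
        split_ifs with h1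
        · exact ⟨fun h => absurd h.symm hcb, fun h => by
            rcases hre with h' | h'
            · exact absurd (h'.symm.trans h).symm hca
            · exact absurd (h'.symm.trans h).symm hcb⟩
        · exact ⟨fun h => absurd h.symm hca, fun h => by
            rcases hre with h' | h'
            · exact absurd (h'.symm.trans h).symm hca
            · exact absurd (h'.symm.trans h).symm hcb⟩
      · rw [garnirFun_of_not_mem he]
  refine labSDom_of_move (blk := r) hab (m := Y.card - U₀.card) (by omega) (by omega) hsize ?_ ?_ fun c hca hcb => ?_
  · rw [hsz, if_pos rfl]
  · rw [hsz, if_neg (Ne.symm hab), if_pos rfl]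
  · rw [hsz, if_neg hca, if_neg hcb]

open scoped Classical in
/-- **The row-Garnir element lies in `J^{▷λ}`** (layer L4 of the integral straightening): for a row
`a`, a part `Y` of a lower and not longer row `b`, and a part `X` of row `a` with `|X| + |Y| > λ_a`,
`∑_{B ⊆ X ∪ Y, |B| = |Y|} f(r_B) ∈ J^{▷λ}` — by inclusion–exclusion over the subsets `U₀` of
`U = row a ∖ X` this is `∑_{U₀} (-1)^{|U₀|} N(U₀)` with every `N(U₀) ∈ x_{r_{U₀}} H ⊆ J^{▷λ}`.
[folklore] -/
theorem garnir_sum_mem_domIdeal (μ : Nat.Partition n) (hab : a ≠ b) {X : Finset (Fin n)} (hX : X ⊆ rowSet r a)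
    (hA : A = rowSet r a ∪ Y) (hY : Y ⊆ rowSet r b) (hbig : blockSize r a < X.card + Y.card)
    (hsize : blockSize r b ≤ blockSize r a) :
    ∑ B ∈ (X ∪ Y).powersetCard Y.card, tabloidSum R μ (garnirFun r a b A B) ∈ domIdeal R r := by
  set U := rowSet r a \ X with hU
  have hrowA : rowSet r a ⊆ A := by rw [hA]; exact Finset.subset_union_left
  have hdisj : Disjoint (rowSet r a) Y := by
    rw [Finset.disjoint_left]
    intro e he heY
    exact hab ((mem_rowSet.1 he).symm.trans (mem_rowSet.1 (hY heY)))
  -- `B ⊆ X ∪ Y` iff `B ⊆ A` and `B` avoids `U`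
  have hset : (X ∪ Y).powersetCard Y.card = (A.powersetCard Y.card).filter (fun B => Disjoint U B) := by
    ext B
    rw [Finset.mem_powersetCard, Finset.mem_filter, Finset.mem_powersetCard]
    constructor
    · rintro ⟨h1, h2⟩
      refine ⟨⟨h1.trans ?_, h2⟩, ?_⟩
      · rw [hA]; exact Finset.union_subset_union hX le_rfl
      · rw [Finset.disjoint_left]
        intro e he heB
        rw [hU, Finset.mem_sdiff] at he
        rcases Finset.mem_union.1 (h1 heB) with h | h
        · exact he.2 h
        · exact Finset.disjoint_left.1 hdisj he.1 h
    · rintro ⟨⟨h1, h2⟩, h3⟩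
      refine ⟨fun e he => ?_, h2⟩
      have heA := h1 he
      rw [hA, Finset.mem_union] at heA
      rcases heA with h | h
      · by_contra hne
        rw [Finset.mem_union, not_or] at hne
        exact Finset.disjoint_left.1 h3 (by rw [hU, Finset.mem_sdiff]; exact ⟨h, hne.1⟩) he
      · exact Finset.mem_union_right _ h
  rw [hset, sum_filter_disjoint_eq_sum_powerset]
  refine Submodule.sum_mem _ fun U₀ hU₀ => zsmul_mem ?_ _
  rw [Finset.mem_powerset] at hU₀
  have hU₀a : U₀ ⊆ rowSet r a := hU₀.trans Finset.sdiff_subset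
  refine sum_tabloidSum_garnir_supset_mem R μ hab hrowA _ (labSDom_garnirFun hab hA hY hU₀a ?_ hsize)
  have h1 := Finset.card_le_card hU₀
  have h2 : U.card = blockSize r a - X.card := by rw [hU, Finset.card_sdiff_of_subset hX, card_rowSet]
  have h3 := Finset.card_le_card hX; rw [card_rowSet] at h3
  omega

end Garnir


/-! ### Straightening: `f(r) ∈ ∑_{𝔳 standard, 𝔳 ⊵ r} R · m_{𝔳𝔱^λ} + J^{▷λ}` (layer L5) -/

section Straighten

variable {n : ℕ}

/-- The position of an entry within its row (the number of smaller entries of the same row).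
[folklore] -/
def colIdx (r : Fin n → ℕ) (e : Fin n) : ℕ := (Finset.univ.filter fun e' : Fin n => e' < e ∧ r e' = r e).card

/-- Within a row the position increases with the entry. [folklore] -/
theorem colIdx_lt_colIdx {r : Fin n → ℕ} {e e' : Fin n} (h : e < e') (hr : r e = r e') : colIdx r e < colIdx r e' := by
  unfold colIdx
  apply Finset.card_lt_card
  rw [Finset.ssubset_iff_of_subset]
  · refine ⟨e, ?_, ?_⟩
    · simp [h, hr]
    · simp
  · intro x hx
    simp only [Finset.mem_filter, Finset.mem_univ, true_and] at hx ⊢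
    exact ⟨hx.1.trans h, hx.2.trans hr⟩

/-- Within a row, comparing positions compares entries. [folklore] -/
theorem le_of_colIdx_le {r : Fin n → ℕ} {e e' : Fin n} (hr : r e = r e') (h : colIdx r e ≤ colIdx r e') : e ≤ e' := by
  by_contra hlt
  exact absurd h (not_le.2 (colIdx_lt_colIdx (not_le.1 hlt) hr.symm))

/-- Positions are smaller than the row size. [folklore] -/
theorem colIdx_lt_blockSize (r : Fin n → ℕ) (e : Fin n) : colIdx r e < blockSize r (r e) := by
  unfold colIdx blockSize
  apply Finset.card_lt_card
  rw [Finset.ssubset_iff_of_subset]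
  · exact ⟨e, by simp, by simp⟩
  · intro x hx
    simp only [Finset.mem_filter, Finset.mem_univ, true_and] at hx ⊢
    exact hx.2

/-- The entries of the row of `e` at positions `≤` that of `e` number `colIdx r e + 1`. [folklore] -/
theorem card_filter_colIdx_le (r : Fin n → ℕ) (e : Fin n) :
    ((rowSet r (r e)).filter fun y => colIdx r y ≤ colIdx r e).card = colIdx r e + 1 := by
  have hset : (rowSet r (r e)).filter (fun y => colIdx r y ≤ colIdx r e) =
      insert e (Finset.univ.filter fun e' : Fin n => e' < e ∧ r e' = r e) := by
    ext y
    simp only [Finset.mem_filter, mem_rowSet, Finset.mem_insert, Finset.mem_univ, true_and]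
    constructor
    · rintro ⟨hy, hle⟩
      rcases (le_of_colIdx_le hy hle).lt_or_eq with h | h
      · exact Or.inr ⟨h, hy⟩
      · exact Or.inl h
    · rintro (rfl | ⟨h, hy⟩)
      · exact ⟨rfl, le_rfl⟩
      · exact ⟨hy, (colIdx_lt_colIdx h hy).le⟩
  rw [hset, Finset.card_insert_of_notMem (by simp), colIdx]

/-- The entries of the row of `e'` at positions `≥` that of `e'` number `λ_{row} - colIdx r e'`.
[folklore] -/
theorem card_filter_le_colIdx (r : Fin n → ℕ) (e' : Fin n) :
    ((rowSet r (r e')).filter fun x => colIdx r e' ≤ colIdx r x).card = blockSize r (r e') - colIdx r e' := by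
  have h1 : ((rowSet r (r e')).filter fun x => ¬ (colIdx r e' ≤ colIdx r x)) =
      Finset.univ.filter (fun x => x < e' ∧ r x = r e') := by
    ext x
    simp only [Finset.mem_filter, mem_rowSet, Finset.mem_univ, true_and, not_le]
    constructor
    · rintro ⟨hx, hlt⟩
      refine ⟨lt_of_not_ge fun hle => ?_, hx⟩
      rcases hle.lt_or_eq with h | h
      · exact absurd hlt (not_lt.2 (colIdx_lt_colIdx h hx.symm).le)
      · subst h; exact lt_irrefl _ hlt
    · rintro ⟨hlt, hx⟩
      exact ⟨hx, colIdx_lt_colIdx hlt hx⟩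
  have h2 := Finset.card_filter_add_card_filter_not (s := rowSet r (r e')) (fun x => colIdx r e' ≤ colIdx r x)
  rw [h1, card_rowSet] at h2
  have h3 : (Finset.univ.filter (fun x => x < e' ∧ r x = r e')).card = colIdx r e' := rfl
  omega

/-- **The tableau of a row function**: entry `e ↦ (its row, its position in the row)`. [folklore] -/
def fillOfRowFun (r : Fin n → ℕ) : Fin n → ℕ × ℕ := fun e => (r e, colIdx r e)

/-- The tableau of a row function is injective. [folklore] -/
theorem fillOfRowFun_injective (r : Fin n → ℕ) : Function.Injective (fillOfRowFun r) := by
  intro e e' h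
  simp only [fillOfRowFun, Prod.mk.injEq] at h
  rcases lt_trichotomy e e' with hlt | heq | hgt
  · exact absurd h.2 (ne_of_lt (colIdx_lt_colIdx hlt h.1))
  · exact heq
  · exact absurd h.2.symm (ne_of_lt (colIdx_lt_colIdx hgt h.1.symm))

/-- **Row functions without descents are standard**: if no larger entry `e'` lies in a strictly
higher row at a position `≤` that of a smaller `e`, the tableau of the row function is a standard
tableau (of shape `λ` when the rows have the sizes `λ_i`). [folklore] -/
theorem isStdFilling_fillOfRowFun (μ : Nat.Partition n) (r : Fin n → ℕ) (hsize : ∀ i, blockSize r i = μ.youngDiagram.rowLen i)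
    (h : ∀ e e' : Fin n, e < e' → r e' < r e → colIdx r e < colIdx r e') :
    Literature.NumberTheory.DiophantineGeometry.IsStdFilling n μ.youngDiagram (fillOfRowFun r) := by
  refine ⟨fun e => ?_, fillOfRowFun_injective r, fun p q hpq hle => ?_⟩
  · show (r e, colIdx r e) ∈ μ.youngDiagram
    rw [YoungDiagram.mem_iff_lt_rowLen, ← hsize]
    exact colIdx_lt_blockSize r e
  · obtain ⟨h1, h2⟩ := Prod.mk_le_mk.1 hle
    rcases h1.lt_or_eq with hlt | heq
    · exact absurd h2 (not_le.2 (h p q hpq hlt))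
    · exact absurd h2 (not_le.2 (colIdx_lt_colIdx hpq heq.symm))

/-- **Descent data**: a row function with a descent has rows `a < b`, a part `X` of row `a` and a
part `Y` of row `b` with every entry of `Y` smaller than every entry of `X` and `|X| + |Y| > λ_a`
(`Y` = the entries of row `b` up to the position of the smaller entry `e`, `X` = the entries of
row `a` from the position of the larger entry `e'` on). [folklore] -/
theorem exists_garnir_data (r : Fin n → ℕ) (h : ¬ ∀ e e' : Fin n, e < e' → r e' < r e → colIdx r e < colIdx r e') :
    ∃ (a b : ℕ) (X Y : Finset (Fin n)), a < b ∧ X ⊆ rowSet r a ∧ Y ⊆ rowSet r b ∧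
      (∀ y ∈ Y, ∀ x ∈ X, y < x) ∧ blockSize r a < X.card + Y.card := by
  push Not at h
  obtain ⟨e, e', hee', hrow, hcol⟩ := h
  refine ⟨r e', r e, (rowSet r (r e')).filter (fun x => colIdx r e' ≤ colIdx r x),
    (rowSet r (r e)).filter (fun y => colIdx r y ≤ colIdx r e), hrow, Finset.filter_subset _ _,
    Finset.filter_subset _ _, fun y hy x hx => ?_, ?_⟩
  · rw [Finset.mem_filter, mem_rowSet] at hy hx
    have hye : y ≤ e := le_of_colIdx_le hy.1 hy.2
    have hex : e' ≤ x := le_of_colIdx_le hx.1.symm hx.2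
    exact lt_of_le_of_lt hye (lt_of_lt_of_le hee' hex)
  · rw [card_filter_le_colIdx, card_filter_colIdx_le]
    have := colIdx_lt_blockSize r e'
    omega

/-! #### Dominance of the Garnir row functions over `r` -/

/-- A row function as a filling datum (only the rows enter the dominance order). [folklore] -/
def toFill (r : Fin n → ℕ) : Fin n → ℕ × ℕ := fun e => (r e, 0)

/-- The rows of `toFill r`. [folklore] -/
@[simp]
theorem toFill_fst (r : Fin n → ℕ) (e : Fin n) : (toFill r e).1 = r e := rfl

/-- Strict dominance of row functions, with a bounded witness. [folklore] -/
def RowSDom (g f : Fin n → ℕ) : Prop :=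
  FillingDominates (toFill g) (toFill f) ∧ ∃ k ≤ n, ∃ i ≤ n, rowCount (toFill f) k i < rowCount (toFill g) k i

/-- Weak after strict dominance is strict. [folklore] -/
theorem RowSDom.of_dom_of_sdom {g f r : Fin n → ℕ} (h₁ : FillingDominates (toFill g) (toFill f)) (h₂ : RowSDom f r) :
    RowSDom g r :=
  ⟨h₁.trans h₂.1, by
    obtain ⟨k, hk, i, hi, hlt⟩ := h₂.2
    exact ⟨k, hk, i, hi, hlt.trans_le (h₁ k i)⟩⟩

/-- **The Garnir row functions strictly dominate `r`**: `r_B` (`B ≠ Y`) arises from `r = r_Y` by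
exchanging entries of `Y` (small, in the low row `b`) with entries of `X` (large, in the high row
`a`), and each exchange is a strict dominance move. [folklore] -/
theorem rowSDom_garnirFun {r : Fin n → ℕ} {a b : ℕ} {X Y : Finset (Fin n)} (hab : a < b) (han : a ≤ n)
    (hX : X ⊆ rowSet r a) (hY : Y ⊆ rowSet r b) (hXY : ∀ y ∈ Y, ∀ x ∈ X, y < x) :
    ∀ (d : ℕ) (B : Finset (Fin n)), B ∈ (X ∪ Y).powersetCard Y.card → (Y \ B).card = d → B ≠ Y →
      RowSDom (garnirFun r a b (rowSet r a ∪ Y) B) r := by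
  classical
  have hdisjXY : Disjoint X Y := by
    rw [Finset.disjoint_left]
    intro e heX heY
    exact lt_irrefl _ (hXY e heY e heX)
  have hdisj : Disjoint (rowSet r a) Y := by
    rw [Finset.disjoint_left]
    intro e he heY
    exact hab.ne ((mem_rowSet.1 he).symm.trans (mem_rowSet.1 (hY heY)))
  intro d
  induction d with
  | zero =>
    intro B hB hd hBY
    rw [Finset.card_eq_zero, Finset.sdiff_eq_empty_iff_subset] at hd
    rw [Finset.mem_powersetCard] at hB
    exact absurd (Finset.eq_of_subset_of_card_le hd hB.2.le).symm hBY
  | succ d ih =>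
    intro B hB hd hBY
    rw [Finset.mem_powersetCard] at hB
    -- pick `y ∈ Y ∖ B` and `x ∈ B ∖ Y ⊆ X`
    obtain ⟨y, hy⟩ : (Y \ B).Nonempty := by rw [← Finset.card_pos, hd]; exact Nat.succ_pos _
    rw [Finset.mem_sdiff] at hy
    obtain ⟨x, hx⟩ : (B \ Y).Nonempty := by
      rw [← Finset.card_pos, Finset.card_sdiff, hB.2]
      have : (Y ∩ B).card < Y.card := by
        apply Finset.card_lt_card
        rw [Finset.ssubset_iff_of_subset Finset.inter_subset_left]
        exact ⟨y, hy.1, fun h => hy.2 (Finset.mem_inter.1 h).2⟩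
      omega
    rw [Finset.mem_sdiff] at hx
    have hxX : x ∈ X := by
      rcases Finset.mem_union.1 (hB.1 hx.1) with h | h
      · exact h
      · exact absurd h hx.2
    have hyx : y < x := hXY y hy.1 x hxX
    have hxy : x ≠ y := (ne_of_lt hyx).symm
    set B₁ := insert y (B.erase x) with hB₁
    have hyB₁ : y ∈ B₁ := Finset.mem_insert_self _ _
    have hxB₁ : x ∉ B₁ := by
      rw [hB₁, Finset.mem_insert, Finset.mem_erase]
      push Not
      exact ⟨hxy, fun h => absurd rfl h⟩
    have hB₁mem : B₁ ∈ (X ∪ Y).powersetCard Y.card := by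
      rw [Finset.mem_powersetCard]
      refine ⟨?_, ?_⟩
      · rw [hB₁]
        exact Finset.insert_subset (Finset.mem_union_right _ hy.1) ((Finset.erase_subset _ _).trans hB.1)
      · rw [hB₁, Finset.card_insert_of_notMem (fun h => hy.2 (Finset.mem_erase.1 h).2), Finset.card_erase_of_mem hx.1, ← hB.2]
        have := Finset.card_pos.2 ⟨x, hx.1⟩
        omega
    have hd₁ : (Y \ B₁).card = d := by
      have : Y \ B₁ = (Y \ B).erase y := by
        ext e
        rw [hB₁, Finset.mem_sdiff, Finset.mem_insert, Finset.mem_erase, Finset.mem_erase, Finset.mem_sdiff]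
        constructor
        · rintro ⟨he, hne⟩
          push Not at hne
          exact ⟨hne.1, he, fun heB => hne.2 (fun hex => hx.2 (hex ▸ he)) heB⟩
        · rintro ⟨hne, he, heB⟩
          refine ⟨he, ?_⟩
          push Not
          exact ⟨hne, fun _ h => heB h⟩
      rw [this, Finset.card_erase_of_mem (Finset.mem_sdiff.2 hy), hd]
      rfl
    -- the rows in `r_{B₁}` and `r_B`
    have hA : ∀ {e}, e ∈ X ∪ Y → e ∈ rowSet r a ∪ Y := fun he => Finset.union_subset_union hX le_rfl he
    have hxA : x ∈ rowSet r a ∪ Y := hA (Finset.mem_union_left _ hxX)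
    have hyA : y ∈ rowSet r a ∪ Y := Finset.mem_union_right _ hy.1
    have step : FillingDominates (toFill (garnirFun r a b (rowSet r a ∪ Y) B)) (toFill (garnirFun r a b (rowSet r a ∪ Y) B₁)) ∧
        rowCount (toFill (garnirFun r a b (rowSet r a ∪ Y) B₁)) (y + 1) a <
          rowCount (toFill (garnirFun r a b (rowSet r a ∪ Y) B)) (y + 1) a := by
      have hfx : (toFill (garnirFun r a b (rowSet r a ∪ Y) B₁) x).1 = a := by
        rw [toFill_fst, garnirFun_of_mem hxA, if_neg hxB₁]
      have hfy : (toFill (garnirFun r a b (rowSet r a ∪ Y) B₁) y).1 = b := by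
        rw [toFill_fst, garnirFun_of_mem hyA, if_pos hyB₁]
      have hgy : (toFill (garnirFun r a b (rowSet r a ∪ Y) B) y).1 = a := by
        rw [toFill_fst, garnirFun_of_mem hyA, if_neg hy.2]
      have hgx : (toFill (garnirFun r a b (rowSet r a ∪ Y) B) x).1 = b := by
        rw [toFill_fst, garnirFun_of_mem hxA, if_pos hx.1]
      have hrow : (toFill (garnirFun r a b (rowSet r a ∪ Y) B₁) x).1 < (toFill (garnirFun r a b (rowSet r a ∪ Y) B₁) y).1 := by
        rw [hfx, hfy]; exact hab
      have hrest : ∀ e, e ≠ y → e ≠ x → (toFill (garnirFun r a b (rowSet r a ∪ Y) B) e).1 =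
          (toFill (garnirFun r a b (rowSet r a ∪ Y) B₁) e).1 := by
        intro e hey hex
        rw [toFill_fst, toFill_fst]
        by_cases he : e ∈ rowSet r a ∪ Y
        · rw [garnirFun_of_mem he, garnirFun_of_mem he]
          have : e ∈ B ↔ e ∈ B₁ := by
            rw [hB₁, Finset.mem_insert, Finset.mem_erase]
            simp [hey, hex]
          rw [if_congr this rfl rfl]
        · rw [garnirFun_of_not_mem he, garnirFun_of_not_mem he]
      refine ⟨fillingDominates_of_exchange hyx hrow (hgy.trans hfx.symm) (hgx.trans hfy.symm) hrest, ?_⟩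
      have := rowCount_lt_of_exchange hyx hrow (hgy.trans hfx.symm) (hgx.trans hfy.symm) hrest
      rwa [hfx] at this
    by_cases hB₁Y : B₁ = Y
    · -- one exchange away from `r` itself
      rw [hB₁Y, garnirFun_self rfl hY] at step
      exact ⟨step.1, y + 1, by have := y.2; omega, a, han, step.2⟩
    · exact RowSDom.of_dom_of_sdom step.1 (ih B₁ hB₁mem hd₁ hB₁Y)

/-! #### The potential and the straightening induction -/

/-- A numeric potential, strictly increasing along strict dominance of row functions. [folklore] -/
def domPot (f : Fin n → ℕ × ℕ) : ℕ := ∑ k ∈ Finset.range (n + 1), ∑ i ∈ Finset.range (n + 1), rowCount f k i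

/-- The potential is bounded. [folklore] -/
theorem domPot_le (f : Fin n → ℕ × ℕ) : domPot f ≤ (n + 1) * ((n + 1) * n) := by
  unfold domPot
  calc _ ≤ ∑ k ∈ Finset.range (n + 1), ∑ i ∈ Finset.range (n + 1), n :=
        Finset.sum_le_sum fun k _ => Finset.sum_le_sum fun i _ => (Finset.card_filter_le _ _).trans (by simp)
    _ = _ := by simp [Finset.sum_const, Finset.card_range]

/-- Strict dominance strictly increases the potential. [folklore] -/
theorem domPot_lt_of_rowSDom {g f : Fin n → ℕ} (h : RowSDom g f) : domPot (toFill f) < domPot (toFill g) := by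
  obtain ⟨hdom, k, hk, i, hi, hlt⟩ := h
  unfold domPot
  refine Finset.sum_lt_sum (fun k' _ => Finset.sum_le_sum fun i' _ => hdom k' i') ⟨k, Finset.mem_range.2 (Nat.lt_succ_of_le hk), ?_⟩
  exact Finset.sum_lt_sum (fun i' _ => hdom k i') ⟨i, Finset.mem_range.2 (Nat.lt_succ_of_le hi), hlt⟩

/-- **The span of the `m_{𝔳𝔱^λ}` over the standard `𝔳 ⊵ r`.** [folklore] -/
def stdSpan (μ : Nat.Partition n) (r : Fin n → ℕ) : Submodule R (MonoidAlgebra R (Perm (Fin n))) :=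
  Submodule.span R {x | ∃ v : StdFilling n μ.youngDiagram,
    FillingDominates (toFill fun e => (v.1 e).1) (toFill r) ∧ x = murphy R v (rowReading μ)}

/-- The spans grow along dominance. [folklore] -/
theorem stdSpan_mono (μ : Nat.Partition n) {r r' : Fin n → ℕ} (h : FillingDominates (toFill r) (toFill r')) :
    stdSpan R μ r ≤ stdSpan R μ r' := by
  refine Submodule.span_mono ?_
  rintro x ⟨v, hv, rfl⟩
  exact ⟨v, hv.trans h, rfl⟩

/-- **Straightening (Murphy; the level-one case of Hu–Mathas' Thm 26 modulo `Ȟ^{▷λ}`)**: every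
tabloid element `f(r)` of shape `λ` lies in the span of the `m_{𝔳𝔱^λ}` over the *standard* `𝔳`
dominating `r`, modulo `J^{▷λ}` — by induction on dominance: a standard `r` is its own
`m_{𝔳𝔱^λ}`; otherwise a descent gives a row-Garnir element in `J^{▷λ}` (`garnir_sum_mem_domIdeal`)
whose other terms are strictly more dominant. [cite: HuMathas2010, Theorem 26] -/
theorem tabloidSum_mem_stdSpan_sup (μ : Nat.Partition n) (r : Fin n → ℕ) :
    tabloidSum R μ r ∈ stdSpan R μ r ⊔ domIdeal R μ.rowOf := by
  classical
  suffices H : ∀ N (r : Fin n → ℕ), (n + 1) * ((n + 1) * n) - domPot (toFill r) = N →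
      tabloidSum R μ r ∈ stdSpan R μ r ⊔ domIdeal R μ.rowOf from H _ r rfl
  intro N
  induction N using Nat.strong_induction_on with
  | _ N ih =>
  intro r hN
  by_cases hreal : ∃ g : Perm (Fin n), rowFunOf μ g = r
  swap
  · push Not at hreal
    rw [tabloidSum_eq_zero R μ hreal]
    exact Submodule.zero_mem _
  obtain ⟨g, rfl⟩ := hreal
  by_cases hstd : ∀ e e' : Fin n, e < e' → rowFunOf μ g e' < rowFunOf μ g e →
      colIdx (rowFunOf μ g) e < colIdx (rowFunOf μ g) e'
  · -- standard: `f(r) = m_{𝔳 𝔱^λ}` for the tableau `𝔳` of `r`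
    let v : StdFilling n μ.youngDiagram :=
      ⟨fillOfRowFun (rowFunOf μ g), isStdFilling_fillOfRowFun μ _ (blockSize_rowFunOf μ g) hstd⟩
    refine Submodule.mem_sup_left (Submodule.subset_span ⟨v, fillingDominates_refl _, ?_⟩)
    rw [murphy_rowReading_right]
    rfl
  · obtain ⟨a, b, X, Y, hab, hX, hY, hXY, hbig⟩ := exists_garnir_data _ hstd
    -- `Y` is nonempty, so `b` is a row of `λ` and `a < b < n`
    have hbn : b < n := by
      have hXle := Finset.card_le_card hX
      rw [card_rowSet] at hXle
      obtain ⟨y, hy⟩ : Y.Nonempty := by rw [← Finset.card_pos]; omega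
      have := mem_rowSet.1 (hY hy)
      rw [← this]
      exact rowFunOf_lt μ g y
    have hsize : blockSize (rowFunOf μ g) b ≤ blockSize (rowFunOf μ g) a := by
      rw [blockSize_rowFunOf, blockSize_rowFunOf]
      exact μ.youngDiagram.rowLen_anti a b hab.le
    have hG := garnir_sum_mem_domIdeal R μ hab.ne hX rfl hY hbig hsize
    rw [domIdeal_congr R (colCount_rowFunOf μ g)] at hG
    have hYmem : Y ∈ (X ∪ Y).powersetCard Y.card := Finset.mem_powersetCard.2 ⟨Finset.subset_union_right, rfl⟩
    rw [← Finset.add_sum_erase _ _ hYmem, garnirFun_self rfl hY] at hG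
    rw [show tabloidSum R μ (rowFunOf μ g) = (tabloidSum R μ (rowFunOf μ g) +
        ∑ B ∈ ((X ∪ Y).powersetCard Y.card).erase Y, tabloidSum R μ (garnirFun (rowFunOf μ g) a b (rowSet (rowFunOf μ g) a ∪ Y) B)) -
        ∑ B ∈ ((X ∪ Y).powersetCard Y.card).erase Y, tabloidSum R μ (garnirFun (rowFunOf μ g) a b (rowSet (rowFunOf μ g) a ∪ Y) B) by
      rw [add_sub_cancel_right]]
    refine Submodule.sub_mem _ (Submodule.mem_sup_right hG) (Submodule.sum_mem _ fun B hB => ?_)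
    rw [Finset.mem_erase] at hB
    have hdomB := rowSDom_garnirFun hab (by omega) hX hY hXY _ B hB.2 rfl hB.1
    have hlt := domPot_lt_of_rowSDom hdomB
    have hle := domPot_le (toFill (garnirFun (rowFunOf μ g) a b (rowSet (rowFunOf μ g) a ∪ Y) B))
    have key := ih _ (by omega) (garnirFun (rowFunOf μ g) a b (rowSet (rowFunOf μ g) a ∪ Y) B) rfl
    exact (sup_le_sup_right (stdSpan_mono R μ hdomB.1) _) key

/-- **Straightening for `g x_λ`**: every `g x_λ` lies in `∑_{𝔳 ⊵ g·𝔱^λ standard} R m_{𝔳𝔱^λ} + J^{▷λ}`.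
[cite: HuMathas2010, Theorem 26] -/
theorem of_mul_murphyX_mem_stdSpan_sup (μ : Nat.Partition n) (g : Perm (Fin n)) :
    MonoidAlgebra.of R _ g * murphyX R μ ∈ stdSpan R μ (rowFunOf μ g) ⊔ domIdeal R μ.rowOf := by
  rw [← tabloidSum_rowFunOf]
  exact tabloidSum_mem_stdSpan_sup R μ _

end Straighten


/-! ### The type of a labelling: every `x_Q` is conjugate to an `x_μ` (layer L6) -/

section TypeOf

variable {n : ℕ}

/-- The multiset of block sizes of a labelling (its type as a multiset). [folklore] -/
def blockSizes (blk : Fin n → ℕ) : Multiset ℕ := (Finset.univ.image blk).val.map (blockSize blk)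

/-- The block sizes sum to `n`. [folklore] -/
theorem blockSizes_sum (blk : Fin n → ℕ) : (blockSizes blk).sum = n := by
  classical
  unfold blockSizes blockSize
  rw [← Finset.sum_eq_multiset_sum,
    ← Finset.card_eq_sum_card_fiberwise (fun x _ => Finset.mem_image_of_mem blk (Finset.mem_univ x)),
    Finset.card_univ, Fintype.card_fin]

/-- The column counts only depend on the multiset of block sizes. [folklore] -/
theorem colCount_eq_sum_blockSizes (blk : Fin n → ℕ) (t : ℕ) : colCount blk t = ((blockSizes blk).map fun s => min s t).sum := by
  rw [colCount, blockSizes, Multiset.map_map, Finset.sum_eq_multiset_sum]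
  rfl

/-- Labellings with the same block sizes have the same column counts. [folklore] -/
theorem colCount_eq_of_blockSizes_eq {blk blk' : Fin n → ℕ} (h : blockSizes blk = blockSizes blk') :
    colCount blk = colCount blk' := by
  funext t; rw [colCount_eq_sum_blockSizes, colCount_eq_sum_blockSizes, h]

/-- For `t ≥ n` all cells are counted: `C_t(Q) = n`. [folklore] -/
theorem colCount_of_le (blk : Fin n → ℕ) {t : ℕ} (ht : n ≤ t) : colCount blk t = n := by
  rw [colCount_eq_sum_blockSizes]
  have hmap : (blockSizes blk).map (fun s => min s t) = blockSizes blk := by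
    conv_rhs => rw [← Multiset.map_id' (blockSizes blk)]
    refine Multiset.map_congr rfl fun s hs => min_eq_left ?_
    -- every block has at most `n` elements
    rw [blockSizes, Multiset.mem_map] at hs
    obtain ⟨b, -, rfl⟩ := hs
    exact ((Finset.card_filter_le _ _).trans (by simp)).trans ht
  rw [hmap, blockSizes_sum]

/-- **The type of a labelling** as a partition of `n`. [folklore] -/
def typeOf (blk : Fin n → ℕ) : Nat.Partition n where
  parts := blockSizes blk
  parts_pos hi := by
    rw [blockSizes, Multiset.mem_map] at hi
    obtain ⟨b, hb, rfl⟩ := hi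
    exact blockSize_pos_of_mem (Finset.mem_def.2 hb)
  parts_sum := blockSizes_sum blk

/-- The rows of `λ` have the lengths `λ_i`. [folklore] -/
theorem rowLen_eq_sortedParts_getElem (μ : Nat.Partition n) {i : ℕ} (hi : i < μ.sortedParts.length) :
    μ.youngDiagram.rowLen i = μ.sortedParts[i] := by
  have h := μ.rowLens_youngDiagram
  have hi' : i < μ.youngDiagram.rowLens.length := by rw [h]; exact hi
  rw [← YoungDiagram.get_rowLens (h := hi')]
  exact List.getElem_of_eq h hi'

/-- The rows used by `𝔱^λ` are `0, …, ℓ(λ) - 1`. [folklore] -/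
theorem image_rowOf (μ : Nat.Partition n) : Finset.univ.image μ.rowOf = Finset.range μ.sortedParts.length := by
  ext i
  rw [Finset.mem_image, Finset.mem_range]
  constructor
  · rintro ⟨e, -, rfl⟩; exact μ.rowOf_lt_length e
  · intro hi
    have hpos : 0 < blockSize μ.rowOf i := by
      rw [blockSize_rowOf, rowLen_eq_sortedParts_getElem μ hi]
      exact μ.pos_of_mem_sortedParts (List.getElem_mem hi)
    obtain ⟨e, he⟩ := Finset.card_pos.1 hpos
    exact ⟨e, Finset.mem_univ _, (Finset.mem_filter.1 he).2⟩

/-- **The block sizes of `𝔱^λ` are the parts of `λ`.** [folklore] -/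
theorem blockSizes_rowOf (μ : Nat.Partition n) : blockSizes μ.rowOf = μ.parts := by
  rw [blockSizes, image_rowOf, Finset.range_val, Multiset.range, Multiset.map_coe]
  have hlist : (List.range μ.sortedParts.length).map (blockSize μ.rowOf) = μ.sortedParts := by
    apply List.ext_getElem
    · simp
    · intro i h1 h2
      rw [List.getElem_map, List.getElem_range, blockSize_rowOf, rowLen_eq_sortedParts_getElem μ h2]
  rw [hlist, Nat.Partition.sortedParts, Multiset.sort_eq]

/-- The block stabilizer only depends on the induced set partition. [folklore] -/
theorem blockStab_congr {blk₁ blk₂ : Fin n → ℕ} (h : ∀ e e', blk₁ e = blk₁ e' ↔ blk₂ e = blk₂ e') :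
    blockStab blk₁ = blockStab blk₂ := by
  ext σ
  simp only [mem_blockStab_iff]
  exact forall_congr' fun i => h _ _

/-- `x_Q` only depends on the induced set partition. [folklore] -/
theorem blockSum_congr {blk₁ blk₂ : Fin n → ℕ} (h : ∀ e e', blk₁ e = blk₁ e' ↔ blk₂ e = blk₂ e') :
    blockSum R blk₁ = blockSum R blk₂ := by
  unfold blockSum; rw [blockStab_congr h]

/-- **Labellings with the same multiset of block sizes induce conjugate set partitions**: match the
labels through a size-preserving bijection (`Equiv.ofFiberEquiv` on the fibres of the size), then
the entries blockwise (`exists_perm_comp_eq`). [folklore] -/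
theorem exists_perm_of_blockSizes_eq {blk blk' : Fin n → ℕ} (h : blockSizes blk = blockSizes blk') :
    ∃ π : Perm (Fin n), ∀ e e' : Fin n, blk (π e) = blk (π e') ↔ blk' e = blk' e' := by
  classical
  -- the finite label sets, fibred by the block size
  set s := Finset.univ.image blk with hs
  set s' := Finset.univ.image blk' with hs'
  have hfilter : ∀ (g : Fin n → ℕ) (v : ℕ),
      ((Finset.univ.image g).filter fun b => blockSize g b = v).card = Multiset.count v (blockSizes g) := by
    intro g v
    rw [blockSizes, Multiset.count_map, ← Finset.filter_val, ← Finset.card_val]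
    congr 1
    ext b
    simp only [eq_comm]
  have e1 : ∀ (g : Fin n → ℕ) (v : ℕ), {a : {b // b ∈ Finset.univ.image g} // blockSize g a.1 = v} ≃
      {b // b ∈ (Finset.univ.image g).filter fun b => blockSize g b = v} := fun g v =>
    (Equiv.subtypeSubtypeEquivSubtypeInter (fun b => b ∈ Finset.univ.image g) (fun b => blockSize g b = v)).trans
      (Equiv.subtypeEquivRight fun b => by rw [Finset.mem_filter])
  have efib : ∀ v : ℕ, {a : {b // b ∈ s'} // blockSize blk' a.1 = v} ≃ {a : {b // b ∈ s} // blockSize blk a.1 = v} := fun v =>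
    (e1 blk' v).trans ((Fintype.equivOfCardEq (by rw [Fintype.card_coe, Fintype.card_coe, hfilter, hfilter, h])).trans (e1 blk v).symm)
  let β : {b // b ∈ s'} ≃ {b // b ∈ s} :=
    Equiv.ofFiberEquiv (f := fun a : {b // b ∈ s'} => blockSize blk' a.1) (g := fun a : {b // b ∈ s} => blockSize blk a.1) efib
  have hβ : ∀ a : {b // b ∈ s'}, blockSize blk (β a).1 = blockSize blk' a.1 := fun a =>
    Equiv.ofFiberEquiv_map (f := fun a : {b // b ∈ s'} => blockSize blk' a.1) (g := fun a : {b // b ∈ s} => blockSize blk a.1) efib a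
  -- relabel `blk'` through `β`
  let blk'' : Fin n → ℕ := fun e => (β ⟨blk' e, Finset.mem_image_of_mem blk' (Finset.mem_univ e)⟩ : ℕ)
  have hsize : ∀ b, blockSize blk b = blockSize blk'' b := by
    intro b
    by_cases hb : b ∈ s
    · -- the block of `b` in `blk''` is the block of `β⁻¹ b` in `blk'`
      have key : blockSize blk'' b = blockSize blk' (β.symm ⟨b, hb⟩).1 := by
        unfold blockSize
        congr 1
        ext e
        simp only [Finset.mem_filter, Finset.mem_univ, true_and, blk'']
        constructor
        · intro he
          have : β ⟨blk' e, Finset.mem_image_of_mem blk' (Finset.mem_univ e)⟩ = ⟨b, hb⟩ := Subtype.ext he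
          rw [← this, Equiv.symm_apply_apply]
        · intro he
          have : (⟨blk' e, Finset.mem_image_of_mem blk' (Finset.mem_univ e)⟩ : {b // b ∈ s'}) = β.symm ⟨b, hb⟩ := Subtype.ext he
          rw [this, Equiv.apply_symm_apply]
      rw [key]
      have := hβ (β.symm ⟨b, hb⟩)
      rw [Equiv.apply_symm_apply] at this
      exact this
    · rw [blockSize_eq_zero_of_not_mem hb, blockSize_eq_zero_of_not_mem]
      intro hb'
      rw [Finset.mem_image] at hb'
      obtain ⟨e, -, he⟩ := hb'
      exact hb (he ▸ (β _).2)
  obtain ⟨π, hπ⟩ := exists_perm_comp_eq blk blk'' hsize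
  refine ⟨π, fun e e' => ?_⟩
  have h1 : blk (π e) = blk'' e := congrFun hπ e
  have h2 : blk (π e') = blk'' e' := congrFun hπ e'
  rw [h1, h2]
  simp only [blk'']
  rw [Subtype.val_inj, β.injective.eq_iff, Subtype.mk.injEq]

/-- **Every `x_Q` is conjugate to the `x_μ` of its type**, and `Q` has the column counts of `μ`.
[folklore] -/
theorem exists_blockSum_eq_conj_murphyX (blk : Fin n → ℕ) :
    ∃ (μ : Nat.Partition n) (π : Perm (Fin n)),
      blockSum R blk = MonoidAlgebra.of R _ π * murphyX R μ * MonoidAlgebra.of R _ π⁻¹ ∧ colCount blk = colCount μ.rowOf := by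
  have hsz : blockSizes (typeOf blk).rowOf = blockSizes blk := by rw [blockSizes_rowOf]; rfl
  obtain ⟨π, hπ⟩ := exists_perm_of_blockSizes_eq hsz
  refine ⟨typeOf blk, π⁻¹, ?_, (colCount_eq_of_blockSizes_eq hsz).symm⟩
  rw [blockSum_congr R (blk₂ := (typeOf blk).rowOf ∘ ⇑π) (fun e e' => (hπ e e').symm),
    show ((typeOf blk).rowOf ∘ ⇑π) = (typeOf blk).rowOf ∘ ⇑(π⁻¹)⁻¹ by rw [inv_inv], blockSum_comp_inv,
    murphyX_eq_blockSum, inv_inv]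

end TypeOf


/-! ### Murphy's standard basis theorem: spanning, and the basis over a field (layer L6) -/

section Spanning

variable {n : ℕ}

/-- The span of the `m_{𝔲𝔳}` of one shape. [folklore] -/
def murphyShapeSpan (μ : Nat.Partition n) : Submodule R (MonoidAlgebra R (Perm (Fin n))) :=
  Submodule.span R {x | ∃ u v : StdFilling n μ.youngDiagram, x = murphy R u v}

/-- `x_λ h ∈ ∑_𝔲 R m_{𝔱^λ𝔲} + J^{▷λ}` (straightening, mirrored by `*`). [cite: HuMathas2010, Theorem 26] -/
theorem murphyX_mul_of_mem (μ : Nat.Partition n) (h : Perm (Fin n)) :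
    murphyX R μ * MonoidAlgebra.of R _ h ∈
      Submodule.span R {x | ∃ u : StdFilling n μ.youngDiagram, x = murphy R (rowReading μ) u} ⊔ domIdeal R μ.rowOf := by
  have key := of_mul_murphyX_mem_stdSpan_sup R μ h⁻¹
  have hmap := Submodule.mem_map_of_mem (f := (grpAlgStar R (G := Perm (Fin n))).toLinearMap) key
  rw [LinearEquiv.coe_toLinearMap, grpAlgStar_mul, grpAlgStar_of, inv_inv, grpAlgStar_murphyX, Submodule.map_sup] at hmap
  have h1 : Submodule.map (grpAlgStar R (G := Perm (Fin n))).toLinearMap (stdSpan R μ (rowFunOf μ h⁻¹)) ≤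
      Submodule.span R {x | ∃ u : StdFilling n μ.youngDiagram, x = murphy R (rowReading μ) u} := by
    rw [stdSpan, Submodule.map_span, Submodule.span_le]
    rintro x ⟨y, ⟨v, -, rfl⟩, rfl⟩
    refine Submodule.subset_span ⟨v, ?_⟩
    rw [LinearEquiv.coe_toLinearMap, grpAlgStar_murphy]
  have h2 : Submodule.map (grpAlgStar R (G := Perm (Fin n))).toLinearMap (domIdeal R μ.rowOf) ≤ domIdeal R μ.rowOf := by
    rintro x ⟨y, hy, rfl⟩
    exact grpAlgStar_mem_domIdeal R hy
  exact sup_le_sup h1 h2 hmap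

/-- `w_𝔳 · ∑_𝔲 R m_{𝔱^λ𝔲} ⊆ ∑ R m_{𝔳𝔲}`. [folklore] -/
theorem of_wordPerm_mul_mem_murphyShapeSpan (μ : Nat.Partition n) (v : StdFilling n μ.youngDiagram) {a : MonoidAlgebra R (Perm (Fin n))}
    (ha : a ∈ Submodule.span R {x | ∃ u : StdFilling n μ.youngDiagram, x = murphy R (rowReading μ) u}) :
    MonoidAlgebra.of R _ (wordPerm v) * a ∈ murphyShapeSpan R μ := by
  induction ha using Submodule.span_induction with
  | mem x hx =>
    obtain ⟨u, rfl⟩ := hx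
    refine Submodule.subset_span ⟨v, u, ?_⟩
    rw [murphy, murphy, wordPerm_rowReading, map_one, one_mul, mul_assoc]
  | zero => rw [mul_zero]; exact Submodule.zero_mem _
  | add x y _ _ hx hy => rw [mul_add]; exact Submodule.add_mem _ hx hy
  | smul r x _ hx => rw [mul_smul_comm]; exact Submodule.smul_mem _ r hx

/-- `w_𝔳 · (∑_𝔲 R m_{𝔱^λ𝔲} + J^{▷λ}) ⊆ ∑ R m_{𝔳𝔲} + J^{▷λ}`. [folklore] -/
theorem of_wordPerm_mul_mem (μ : Nat.Partition n) (v : StdFilling n μ.youngDiagram) {x : MonoidAlgebra R (Perm (Fin n))}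
    (hx : x ∈ Submodule.span R {x | ∃ u : StdFilling n μ.youngDiagram, x = murphy R (rowReading μ) u} ⊔ domIdeal R μ.rowOf) :
    MonoidAlgebra.of R _ (wordPerm v) * x ∈ murphyShapeSpan R μ ⊔ domIdeal R μ.rowOf := by
  obtain ⟨a, ha, j, hj, rfl⟩ := Submodule.mem_sup.1 hx
  rw [mul_add]
  exact Submodule.add_mem _ (Submodule.mem_sup_left (of_wordPerm_mul_mem_murphyShapeSpan R μ v ha))
    (Submodule.mem_sup_right (of_mul_mem_domIdeal R _ hj))

/-- `(∑_𝔳 R m_{𝔳𝔱^λ}) · h ⊆ ∑ R m_{𝔲𝔳} + J^{▷λ}`. [folklore] -/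
theorem stdSpan_mul_of_mem (μ : Nat.Partition n) {r : Fin n → ℕ} (h : Perm (Fin n)) {a : MonoidAlgebra R (Perm (Fin n))}
    (ha : a ∈ stdSpan R μ r) : a * MonoidAlgebra.of R _ h ∈ murphyShapeSpan R μ ⊔ domIdeal R μ.rowOf := by
  induction ha using Submodule.span_induction with
  | mem x hx =>
    obtain ⟨v, -, rfl⟩ := hx
    rw [murphy, wordPerm_rowReading, inv_one, map_one, mul_one, mul_assoc]
    exact of_wordPerm_mul_mem R μ v (murphyX_mul_of_mem R μ h)
  | zero => rw [zero_mul]; exact Submodule.zero_mem _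
  | add x y _ _ hx hy => rw [add_mul]; exact Submodule.add_mem _ hx hy
  | smul r x _ hx => rw [smul_mul_assoc]; exact Submodule.smul_mem _ r hx

/-- **`g x_λ h ∈ ∑ R m_{𝔲𝔳} + J^{▷λ}`** (straightening on both sides). [cite: HuMathas2010, Theorem 26] -/
theorem of_mul_murphyX_mul_of_mem (μ : Nat.Partition n) (g h : Perm (Fin n)) :
    MonoidAlgebra.of R _ g * murphyX R μ * MonoidAlgebra.of R _ h ∈ murphyShapeSpan R μ ⊔ domIdeal R μ.rowOf := by
  obtain ⟨a, ha, j, hj, hsum⟩ := Submodule.mem_sup.1 (of_mul_murphyX_mem_stdSpan_sup R μ g)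
  rw [← hsum, add_mul]
  exact Submodule.add_mem _ (stdSpan_mul_of_mem R μ h ha) (Submodule.mem_sup_right (mul_of_mem_domIdeal R _ hj))

/-- **The span of the `m_{𝔲𝔳}` of all shapes dominating `Q`.** [folklore] -/
def murphySpanDom (Q : Fin n → ℕ) : Submodule R (MonoidAlgebra R (Perm (Fin n))) :=
  Submodule.span R {x | ∃ (μ : Nat.Partition n) (u v : StdFilling n μ.youngDiagram), LabDom μ.rowOf Q ∧ x = murphy R u v}

/-- **The span of the `m_{𝔲𝔳}` of all shapes strictly dominating `Q`** (Murphy's `Ȟ^{▷λ}` for `Q` of type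
`λ`). [folklore] -/
def murphySpanSDom (Q : Fin n → ℕ) : Submodule R (MonoidAlgebra R (Perm (Fin n))) :=
  Submodule.span R {x | ∃ (μ : Nat.Partition n) (u v : StdFilling n μ.youngDiagram), LabSDom μ.rowOf Q ∧ x = murphy R u v}

/-- Monotonicity in `Q`. [folklore] -/
theorem murphySpanDom_mono {Q Q' : Fin n → ℕ} (h : LabDom Q' Q) : murphySpanDom R Q' ≤ murphySpanDom R Q := by
  refine Submodule.span_mono ?_
  rintro x ⟨μ, u, v, hμ, rfl⟩
  exact ⟨μ, u, v, hμ.trans h, rfl⟩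

/-- The shapes dominating a `Q' ▷ Q` strictly dominate `Q`. [folklore] -/
theorem murphySpanDom_le_murphySpanSDom {Q Q' : Fin n → ℕ} (h : LabSDom Q' Q) : murphySpanDom R Q' ≤ murphySpanSDom R Q := by
  refine Submodule.span_mono ?_
  rintro x ⟨μ, u, v, hμ, rfl⟩
  exact ⟨μ, u, v, hμ.trans_sdom h, rfl⟩

/-- The strictly dominating span is contained in the dominating one. [folklore] -/
theorem murphySpanSDom_le_murphySpanDom (Q : Fin n → ℕ) : murphySpanSDom R Q ≤ murphySpanDom R Q := by
  refine Submodule.span_mono ?_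
  rintro x ⟨μ, u, v, hμ, rfl⟩
  exact ⟨μ, u, v, hμ.1, rfl⟩

/-- The `m_{𝔲𝔳}` of shape `λ` lie in the span over the shapes dominating `Q` when `λ ⊵ Q`. [folklore] -/
theorem murphyShapeSpan_le_murphySpanDom {μ : Nat.Partition n} {Q : Fin n → ℕ} (h : LabDom μ.rowOf Q) :
    murphyShapeSpan R μ ≤ murphySpanDom R Q := by
  refine Submodule.span_mono ?_
  rintro x ⟨u, v, rfl⟩
  exact ⟨μ, u, v, h, rfl⟩

/-- The numeric potential `∑_{t ≤ n} C_t(Q)` decreases strictly along strict dominance. [folklore] -/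
theorem sum_colCount_lt_of_labSDom {Q Q' : Fin n → ℕ} (h : LabSDom Q' Q) :
    ∑ t ∈ Finset.range (n + 1), colCount Q' t < ∑ t ∈ Finset.range (n + 1), colCount Q t := by
  obtain ⟨t₀, ht₀⟩ := h.2
  have ht₀n : t₀ ≤ n := by
    by_contra hlt
    rw [colCount_of_le Q' (not_le.1 hlt).le, colCount_of_le Q (not_le.1 hlt).le] at ht₀
    exact lt_irrefl _ ht₀
  exact Finset.sum_lt_sum (fun t _ => h.1 t) ⟨t₀, Finset.mem_range.2 (Nat.lt_succ_of_le ht₀n), ht₀⟩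

/-- **Every `g x_Q h` lies in the span of the `m_{𝔲𝔳}` of the shapes dominating `Q`** (downward
induction on dominance: conjugate `x_Q` to the `x_μ` of its type, straighten on both sides, and
treat the terms of `J^{▷μ}` by induction). [cite: HuMathas2010, Theorem 26] -/
theorem conj_blockSum_mem_murphySpanDom (Q : Fin n → ℕ) (g h : Perm (Fin n)) :
    MonoidAlgebra.of R _ g * blockSum R Q * MonoidAlgebra.of R _ h ∈ murphySpanDom R Q := by
  suffices H : ∀ N (Q : Fin n → ℕ), ∑ t ∈ Finset.range (n + 1), colCount Q t = N → ∀ g h : Perm (Fin n),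
      MonoidAlgebra.of R _ g * blockSum R Q * MonoidAlgebra.of R _ h ∈ murphySpanDom R Q from H _ Q rfl g h
  intro N
  induction N using Nat.strong_induction_on with
  | _ N ih =>
  intro Q hN g h
  obtain ⟨μ, π, hx, hcc⟩ := exists_blockSum_eq_conj_murphyX R Q
  have hdomμ : LabDom μ.rowOf Q := fun t => (congrFun hcc t).ge
  rw [hx, show MonoidAlgebra.of R _ g * (MonoidAlgebra.of R _ π * murphyX R μ * MonoidAlgebra.of R _ π⁻¹) * MonoidAlgebra.of R _ h =
      MonoidAlgebra.of R _ (g * π) * murphyX R μ * MonoidAlgebra.of R _ (π⁻¹ * h) by simp only [map_mul, mul_assoc]]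
  refine (sup_le (murphyShapeSpan_le_murphySpanDom R hdomμ) ?_) (of_mul_murphyX_mul_of_mem R μ _ _)
  -- the terms of `J^{▷μ} = J^{▷Q}` by induction
  rw [← domIdeal_congr R hcc, domIdeal, Submodule.span_le]
  rintro x ⟨g', h', Q', hQ', rfl⟩
  have hlt : ∑ t ∈ Finset.range (n + 1), colCount Q' t < N := hN ▸ sum_colCount_lt_of_labSDom hQ'
  exact murphySpanDom_mono R hQ'.1 (ih _ hlt Q' rfl g' h')

/-- **`J^{▷Q}` is spanned by the `m_{𝔲𝔳}` of the shapes strictly dominating `Q`** (one inclusion; the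
other is the cellularity of the Murphy basis). [cite: HuMathas2010, Theorem 26] -/
theorem domIdeal_le_murphySpanSDom (Q : Fin n → ℕ) : domIdeal R Q ≤ murphySpanSDom R Q := by
  rw [domIdeal, Submodule.span_le]
  rintro x ⟨g, h, Q', hQ', rfl⟩
  exact murphySpanDom_le_murphySpanSDom R hQ' (conj_blockSum_mem_murphySpanDom R Q' g h)

/-- A labelling with all blocks singletons has `x_Q = 1`. [folklore] -/
theorem blockSum_eq_one_of_injective {Q : Fin n → ℕ} (hQ : Function.Injective Q) : blockSum R Q = 1 := by
  classical
  unfold blockSum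
  rw [show (Finset.univ.filter fun σ : Perm (Fin n) => σ ∈ blockStab Q) = {1} by
    ext σ
    rw [Finset.mem_filter, Finset.mem_singleton, mem_blockStab_iff, and_iff_right (Finset.mem_univ _)]
    constructor
    · intro h; ext i; exact congrArg Fin.val (hQ (h i))
    · rintro rfl i; rfl]
  rw [Finset.sum_singleton, map_one]

/-- **Murphy's elements span `R[S_n]`** (over any commutative ring). [cite: HuMathas2010, Theorem 26] -/
theorem span_murphy_eq_top :
    Submodule.span R (Set.range fun t : TableauPair n => murphy R t.2.1 t.2.2) = ⊤ := by
  rw [eq_top_iff]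
  -- every group element lies in the span (`g = g · x_{(1ⁿ)} · 1`)
  have hof : ∀ g : Perm (Fin n), MonoidAlgebra.of R _ g ∈ Submodule.span R (Set.range fun t : TableauPair n => murphy R t.2.1 t.2.2) := by
    intro g
    have key := conj_blockSum_mem_murphySpanDom R (fun e : Fin n => (e : ℕ)) g 1
    rw [blockSum_eq_one_of_injective R Fin.val_injective, mul_one, map_one, mul_one] at key
    refine (Submodule.span_le.2 ?_) key
    rintro x ⟨μ, u, v, -, rfl⟩
    exact Submodule.subset_span ⟨⟨μ, u, v⟩, rfl⟩
  rintro x -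
  induction x using MonoidAlgebra.induction_on with
  | hM g => exact hof g
  | hadd x y hx hy => exact Submodule.add_mem _ hx hy
  | hsmul r x hx => exact Submodule.smul_mem _ r hx

/-- **Murphy's standard basis `{m_{𝔰𝔱}}` of `k[S_n]`** over a field, indexed by the pairs of standard
tableaux of the same shape (`TableauPair n`; `n!` of them, `card_tableauPair`): spanning plus the
count `n! = dim k[S_n]`. (Hu–Mathas' Theorem 26 at level one and `q = 1`; G. E. Murphy 1992/95.)
[cite: HuMathas2010, Theorem 26] -/
def murphyBasis (k : Type*) [Field k] (n : ℕ) : Module.Basis (TableauPair n) k (MonoidAlgebra k (Perm (Fin n))) :=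
  basisOfTopLeSpanOfCardEqFinrank (fun t : TableauPair n => murphy k t.2.1 t.2.2) (span_murphy_eq_top k).ge
    (by rw [card_tableauPair, finrank_monoidAlgebra_perm_eq_factorial])

/-- The vectors of the Murphy basis. [folklore] -/
theorem murphyBasis_apply (k : Type*) [Field k] (t : TableauPair n) : murphyBasis k n t = murphy k t.2.1 t.2.2 := by
  rw [murphyBasis, coe_basisOfTopLeSpanOfCardEqFinrank]

/-- The Murphy elements are linearly independent over a field. [folklore] -/
theorem linearIndependent_murphy (k : Type*) [Field k] :
    LinearIndependent k fun t : TableauPair n => murphy k t.2.1 t.2.2 := by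
  have := (murphyBasis k n).linearIndependent
  rwa [murphyBasis, coe_basisOfTopLeSpanOfCardEqFinrank] at this

end Spanning




end Literature.RepresentationTheory.FiniteGroups
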